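import Literature.Geometry.Kaehler.ComplexTorusHodgeLieAlgebraSiegelDimension
import Literature.Geometry.Kaehler.ComplexTorusHodgeLieAlgebraCommutant
import Literature.Geometry.Kaehler.ComplexTorusHodgeGeneralEndomorphisms
import Literature.Geometry.Kaehler.ComplexTorusSymplecticHodgeGroupPowersDivisorClasses
import Literature.Geometry.Kaehler.ComplexTorusHodgeLieAlgebraRatForm
import Literature.Geometry.Kaehler.ComplexTorusLieAlgebraCentersDefinedOverQ
import Literature.AlgebraicGeometry.Motives.HodgeThetaSubalgebraSymplecticRankFour
import Literature.AlgebraicGeometry.Motives.HodgeThetaSubalgebraSymplecticRankSixHodge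
import HarnessLib

/-!
# An abelian surface — and (§4) an abelian threefold — with `End_ℚ(X) = ℚ` is Hodge-general: `Hg(X) = Sp(V, E)`
# (Moonen–Zarhin 1999 (2.2)/(2.3), Type I(1)), through the irreducibility of `V_ℂ` under `𝔤 = Lie Hg(X)(ℂ)` for every
# polarised complex torus with `End_ℚ(X) = ℚ`

Layer `Literature/Geometry/Kaehler`, namespace `Literature.Geometry.Kaehler.ComplexTorus`; lane `lit-hodgefound` (Track 2
foundations library), Layer A3/A4, prover seat p17 (generation 47), self-proposed rows g47-#1 (§0–§3) and g47-#2 (§4, add-only) of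
`run/shared/lean/pub/lit-hodgefound/SKELETON.md`.  THEOREMS ONLY: no definition, no named fact, no instance, no instance
attribute (the commutator bracket `LieRing.ofAssociativeRing` — a non-instance in Mathlib — is only bound by `letI` inside
proofs), net debt 0.

## The printed theorem and its mechanism

B. Moonen, Yu. G. Zarhin, *Hodge classes on abelian varieties of low dimension*, Math. Ann. 315 (1999) 711–733, §2
(held `paper:arxiv-math_9901113`, p0005 L19–L22 and L55–L58): "For `g := dim(X) ≤ 3` and `g = 5` we always find that
`Hg(X) = Sp_D(V,φ)`. […] it follows that `B(Xⁿ) = D(Xⁿ)` for all `n`. […] In particular the Hodge conjecture is true for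
all such `Xⁿ`."; "(2.2) **g = 2.** There are four cases. Type I(1): `X` is an abelian surface with `End⁰(X) = ℚ`. Then
`Hg(X) = Sp(V,φ) ≅ Sp_{4,ℚ}`."; (2.3) (p0005 L84–L86): "**g = 3.** […] Type I(1): `X` is an abelian 3-fold with `End⁰(X) = ℚ`.
Then `Hg(X) = Sp(V,φ) ≅ Sp_{6,ℚ}`."

THE MECHANISM is the tree's vocabulary-free Lie-algebra core of that sentence,
`Literature.AlgebraicGeometry.Motives.HodgeStructure.SymplecticTheta.core_of_irreducible`
(`Motives/HodgeThetaSubalgebraSymplecticRankFour` §1: a bracket-closed complex space `𝔊` of `ω`-skew operators of a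
complex symplectic space `(M, ω)` containing an involution `T` whose `±1`-eigenspaces are PLANES, acting irreducibly on
`M`, contains the Siegel parts `𝔲^±` and the Levi `𝔤𝔩(P)` of `𝔰𝔭(M, ω)`), here run on the PERIOD-MATRIX side of the tree:
`M = V_ℂ = ℂ^ι`, `ω = E_ℂ` (Gram matrix `latticeGram Φ η ⊗ 1`), `𝔊 = 𝔤 = Lie Hg(X)(ℂ) = hodgeGroupLieC Φ` (a complex
subspace by p17's `smul_mem_hodgeGroupLieC`, transported to `End(ℂ^ι)` along `Matrix.toLin'`), `T = -i(J ⊗ 1)`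
(`J = jMatrix Φ`; `T = +1` on `V^{-1,0} = hodgeFiltrationConj J`, `T = -1` on `V^{0,-1} = hodgeFiltration J`, planes when
`g = 2` by `two_mul_finrank_hodgeFiltration`).  The one new input is

**§1 THE IRREDUCIBILITY OF `V_ℂ` UNDER `𝔤` WHEN `End_ℚ(X) = ℚ`** (every polarised complex torus, any dimension;
`IsRiemannForm.eq_bot_or_eq_top_of_forall_mulVec_mem`): a `𝔤`-stable complex subspace `U ⊆ V_ℂ` is `0` or `V_ℂ`.
Proof (the device of Zarhin 1983 §2 / the tree's `SymplecticTheta.eq_bot_or_top_of_stable`, in matrices): `U` is graded by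
`J ⊗ 1 ∈ 𝔤`; `U† := {y | E_ℂ(y, ū) = 0 ∀ u ∈ U}` is `𝔤`-stable because `𝔤 ⊆ 𝔰𝔭(V_ℂ, E_ℂ)`
(`IsRiemannForm.transpose_mul_map_latticeGram_add_eq_zero_of_mem_hodgeGroupLieC`) and `𝔤̄ = 𝔤`
(`map_conj_mem_hodgeGroupLieC`); `U ∩ U† = 0` by the second Riemann bilinear relation `i E_ℂ(v̄, v) > 0` on `V^{0,-1}`
(the tree's `I_mul_star_dotProduct_mulVec_pos_of_mem_hodgeFiltration`) applied to the graded pieces; `dim U† ≥ dim V_ℂ - dim U`;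
so `V_ℂ = U ⊕ U†` and the projector onto `U` commutes with `𝔤 ⊇ 𝔥𝔤_ℝ ⊗ 1`, hence its real and imaginary parts lie in
the commutant `End(V_ℝ)^{𝔥𝔤_ℝ} = End_ℚ(X) ⊗_ℚ ℝ = ℝ · 1` (Lange Prop. 7.2.5 / Exercise 7.2.4 (3), the tree's
`forall_hodgeGroupLie_comm_iff_mem_span_endAlgRat`): the projector is a scalar, `0` or `1`.  Conversely
(`endAlgRat_eq_bot_of_forall_eq_bot_or_eq_top`) irreducibility forces `End_ℚ(X) = ℚ` (an endomorphism commutes with `𝔤`,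
so each of its complex eigenspaces is `𝔤`-stable), whence **`V_ℂ` is `𝔤`-irreducible iff `End_ℚ(X) = ℚ`**
(`IsRiemannForm.forall_eq_bot_or_eq_top_iff_endAlgRat_eq_bot`) — "`End_ℚ(X) = End_{Hg(X)}(H_1(X,ℚ))`" (Lange §7.2.4
Exercise (3)) read through Schur's lemma.

**§2 THE THEOREM** (`g = 2`): every `E_ℂ`-skew complex matrix lies in `𝔤`
(`IsRiemannForm.mem_hodgeGroupLieC_of_transpose_mul_add_eq_zero_of_finrank_eq_two`: the core theorem for `T` and for `-T`
gives `𝔲⁺ ⊕ 𝔤𝔩(V^{-1,0}) ⊕ 𝔲⁻ ⊆ 𝔤`, and a skew `Y` is `Y₋ + Y₀ + Y₊` along `ad T`, `SymplecticTheta.exists_decomp`); hence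
`𝔰𝔭(V, E) ⊆ 𝔥𝔤_ℝ` and **`Hg(X) = Sp(V, E)`** by the tree's Lie-algebra criterion
`IsRiemannForm.hodgeGroup_eq_spGroup_iff_forall_mem_hodgeGroupLie` (Lange §7.3.1, proof of Prop. 7.3.2):
`IsRiemannForm.hodgeGroup_eq_spGroup_of_finrank_eq_two_of_endAlgRat_eq_bot`; with the tree's converse
`IsRiemannForm.endAlgRat_eq_bot_of_hodgeGroup_eq_spGroup` (Schur), **for abelian surfaces `Hg(X) = Sp(V, E) ⟺ End_ℚ(X) = ℚ`**
(`IsRiemannForm.hodgeGroup_eq_spGroup_iff_endAlgRat_eq_bot_of_finrank_eq_two`), and the `IsAbelianVariety.` forms.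

**§3 CONSEQUENCES BY NAME**: `𝔥𝔤_ℝ = 𝔰𝔭(V, E)`, `dim 𝔥𝔤_ℝ = 10`, `dim 𝔨 = 4`, `dim 𝔭 = 6 = dim_ℝ 𝔥₂`, `dim_ℂ 𝔤^{-1,1} = 3`
(the SIXTH of the six types of p17's `ComplexTorusHodgeLieAlgebraAbelianSurfacesSixTypes`, now identified with Type I(1));
"`B(Xⁿ) = D(Xⁿ)` for all `n`": **every power of an abelian surface with `End_ℚ(X) = ℚ` has all its Hodge classes generated by
divisor classes** (`IsRiemannForm.forall_divisorClasses_eq_hodgeClasses_powPeriod_of_finrank_eq_two_of_endAlgRat_eq_bot`, through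
the tree's `…_of_hodgeGroup_eq_spGroup`, Lange Prop. 7.3.3 / MZ (1.8)); `X` is simple.

**§4 THE THREEFOLD** (`g = 3`, add-only row g47-#2): `IsRiemannForm.mem_hodgeGroupLieC_of_transpose_mul_add_eq_zero_of_finrank_eq_three`
— the rank-six dichotomy `Motives.HodgeStructure.SymplecticThetaSix.core_dichotomy` (consumed BY NAME) either gives
`𝔲⁺ ⊕ 𝔤𝔩(V^{-1,0}) ⊕ 𝔲⁻ ⊆ 𝔤` as for `g = 2`, or the E³-type skeleton of MZ (2.5), on which `SymplecticThetaSix.skeleton_radical`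
(BY NAME) produces a nonzero radical vector of the invariant form `Ψ(X, Z) = tr_{V_ℂ}(XZ) - 2 tr_𝔤(ad X ad Z)` with `Rad Ψ ⊆ 𝔷(T)`;
on the PERIOD-MATRIX side the `ℚ`-structure is p36's `𝒜 = hodgeGroupLieRat Φ` (`𝔤 = 𝒜 ⊗ ℂ`,
`mem_hodgeGroupLieC_iff_mem_span_hodgeGroupLieRat`; `ℂ`-independence of a `ℚ`-basis by `linearIndependent_map_ratCast`): `Ψ` is
rational on `𝒜 × 𝒜` (traces of rational matrices; structure constants of `ad ∘ ad` in a `ℚ`-basis), so `Rad Ψ` has a nonzero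
RATIONAL vector (descent of `det = 0`, Hoffman–Kunze §1.4), which commutes with `T = -i(J ⊗ 1)`, hence with `J`, hence lies in
`End_ℚ(X) = ℚ` (`mem_endAlgRat_iff`) with trace `0` (`trace_eq_zero_of_mem_hodgeGroupLieRat`): it vanishes — contradiction.  Hence
**`Hg(X) = Sp(V, E) ≅ Sp₆` for every polarised complex torus of dimension `3` with `End_ℚ(X) = ℚ`**
(`IsRiemannForm.hodgeGroup_eq_spGroup_of_finrank_eq_three_of_endAlgRat_eq_bot`), the IFF, the `IsAbelianVariety` forms,
`dim 𝔥𝔤_ℝ = 21`, `dim_ℂ 𝔤^{-1,1} = 6 = dim 𝔥₃`, "`B(Xⁿ) = D(Xⁿ)` for all `n`", and MZ's "for `g ≤ 3` … `Hg(X) = Sp(V, φ)`" in the case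
`End_ℚ(X) = ℚ` (`IsRiemannForm.hodgeGroup_eq_spGroup_of_finrank_le_three_of_endAlgRat_eq_bot`, `2 ≤ g ≤ 3`).

NOT here: the other types of (2.2)/(2.3) (real multiplication, quaternions, CM fields, imaginary quadratic `End⁰`), `g = 5`
(2.4); `Hg = Sp` as an equality of `ℚ`-group schemes (the tree's `hodgeGroup`/`spGroup` are the real points inside `SL_ι(ℝ)`,
as everywhere in this layer).

## References

* [MoonenZarhin1999LowDim] B. Moonen, Yu. G. Zarhin, Math. Ann. 315 (1999) 711–733 = arXiv:math/9901113, §1 (1.8), §2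
  p. 715 and (2.2) (held `paper:arxiv-math_9901113`, p0004 L74–L78, p0005 L19–L22, L55–L58).
* [Lange2023AbelianVarietiesComplex] H. Lange, *Abelian Varieties over the Complex Numbers* (2023), §7.2.2 Prop. 7.2.5,
  §7.2.4 Exercise (3) ("`End_ℚ(X) = End_{Hg(X)}(H_1(X,ℚ))`"), §7.3.1 Prop. 7.3.2 (proof) and Prop. 7.3.3.
* [Zarhin1983HodgeGroupsK3] Yu. G. Zarhin, *Hodge groups of K3 surfaces*, J. reine angew. Math. 341 (1983), §2 (the
  orthogonal-complement device for stable subspaces of a polarised Hodge structure).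
* [Gordon1997] B. B. Gordon, *A survey of the Hodge conjecture for abelian varieties*, arXiv:alg-geom/9709030, §1.6.2,
  Thm. 7.5 (Hazama / Murty: `Hg = Sp ⟺ no type III and B(Xⁿ) = D(Xⁿ) ∀ n`).
* [GoodmanWallachGTM255] R. Goodman, N. R. Wallach, GTM 255 (2009), §2.1.2 (`𝔰𝔭` in Siegel block form), Thm. 1.4.10.
* [GreenGriffithsKerr2012] M. Green, P. Griffiths, M. Kerr, *Mumford–Tate Groups and Domains* (2012), §II.C, Lemma after
  (II.C.1) ("`𝒜_ℂ = 𝒜 ⊗ ℂ`"), §II.A (p. 46).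
* [HoffmanKunze1971LinearAlgebra] K. Hoffman, R. Kunze, *Linear Algebra*, 2nd ed. (1971), §1.4 (closing remark: a linear system
  with coefficients in a subfield solvable over the field is solvable over the subfield), §5.4.
-/

noncomputable section

open scoped Matrix ComplexOrder

open Set Function Module Matrix
open Literature.AlgebraicGeometry.Motives

namespace Literature.Geometry.Kaehler

namespace ComplexTorus

/-! ## §0 Linear algebra over `ℂ^ι`: the form `x ⬝ᵥ G y`, skewness, conjugation, real and imaginary parts -/

section LinearAlgebra

variable {ι : Type*} [Fintype ι] [DecidableEq ι]

omit [DecidableEq ι] in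
/-- `ᵗM G + G M = 0 ⟹ ω(Mx, y) + ω(x, My) = 0` for `ω(x, y) = ᵗx G y`. [cite: GoodmanWallachGTM255, §2.1.2] -/
private theorem dotProduct_mulVec_add_eq_zero_of_transpose_mul_add_eq_zero {M G : Matrix ι ι ℂ}
    (hM : Mᵀ * G + G * M = 0) (x y : ι → ℂ) :
    (M *ᵥ x) ⬝ᵥ (G *ᵥ y) + x ⬝ᵥ (G *ᵥ (M *ᵥ y)) = 0 := by
  have h1 : (M *ᵥ x) ⬝ᵥ (G *ᵥ y) = x ⬝ᵥ (Mᵀ *ᵥ (G *ᵥ y)) := by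
    rw [Matrix.dotProduct_mulVec x Mᵀ, Matrix.vecMul_transpose]
  rw [h1, Matrix.mulVec_mulVec, Matrix.mulVec_mulVec, ← dotProduct_add, ← Matrix.add_mulVec, hM, Matrix.zero_mulVec,
    dotProduct_zero]

omit [DecidableEq ι] in
/-- `ᵗG = -G ⟹ ω(x, y) = -ω(y, x)`. [cite: Lange2023AbelianVarietiesComplex, §1.5.1] -/
private theorem dotProduct_mulVec_eq_neg_of_transpose_eq_neg {G : Matrix ι ι ℂ} (hG : Gᵀ = -G) (x y : ι → ℂ) :
    x ⬝ᵥ (G *ᵥ y) = -(y ⬝ᵥ (G *ᵥ x)) := by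
  rw [Matrix.dotProduct_mulVec x G y, ← Matrix.mulVec_transpose, hG, Matrix.neg_mulVec, neg_dotProduct, dotProduct_comm]

omit [DecidableEq ι] in
/-- `Z v̄ = \overline{Z̄ v}`. [cite: Lange2023AbelianVarietiesComplex, §7.1.1 Prop. 7.1.1 (proof: "`h(z)(v̄) = \overline{h(z)(v)}`")] -/
private theorem mulVec_star_eq_star_map_conj_mulVec (Z : Matrix ι ι ℂ) (u : ι → ℂ) :
    Z *ᵥ star u = star (Z.map (starRingEnd ℂ) *ᵥ u) := by
  have hZ : (Z.map (starRingEnd ℂ)).map (starRingEnd ℂ) = Z := by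
    ext i j
    simp [Matrix.map_apply]
  rw [star_mulVec_eq_map_conj_mulVec_star, hZ]

omit [DecidableEq ι] in
/-- Skew operators are closed under the commutator. [cite: GoodmanWallachGTM255, §2.1.2] -/
private theorem skew_commutator₄₇ {M : Type*} [AddCommGroup M] [Module ℂ M]
    (ω : LinearMap.BilinForm ℂ M) {Y Z : Module.End ℂ M} (hY : ∀ x y, ω (Y x) y + ω x (Y y) = 0)
    (hZ : ∀ x y, ω (Z x) y + ω x (Z y) = 0) (x y : M) :
    ω ((Y * Z - Z * Y) x) y + ω x ((Y * Z - Z * Y) y) = 0 := by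
  simp only [LinearMap.sub_apply, Module.End.mul_apply, map_sub, LinearMap.sub_apply]
  have h1 := hY (Z x) y
  have h2 := hZ x (Y y)
  have h3 := hZ (Y x) y
  have h4 := hY x (Z y)
  linear_combination h1 - h3 + h4 - h2

omit [DecidableEq ι] in
/-- Realification of a real matrix equation `ᵗX G + G X = 0`. [folklore] -/
private theorem transpose_map_mul_add_eq_zero {X G : Matrix ι ι ℝ} (h : Xᵀ * G + G * X = 0) :
    (X.map Complex.ofRealHom)ᵀ * G.map Complex.ofRealHom + G.map Complex.ofRealHom * X.map Complex.ofRealHom = 0 := by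
  have h' := congrArg (fun M : Matrix ι ι ℝ ↦ M.map Complex.ofRealHom) h
  simpa only [Matrix.map_add _ (map_add Complex.ofRealHom), Matrix.map_mul, Matrix.transpose_map,
    Matrix.map_zero _ (map_zero Complex.ofRealHom)] using h'

omit [DecidableEq ι] in
/-- `Re((X ⊗ 1) P) = X · Re P` for a real `X`. [folklore] -/
private theorem map_re_ofRealHom_mul (X : Matrix ι ι ℝ) (P : Matrix ι ι ℂ) :
    (X.map Complex.ofRealHom * P).map Complex.re = X * P.map Complex.re := by
  ext i j
  simp only [Matrix.map_apply, Matrix.mul_apply, Complex.re_sum, Complex.ofRealHom_eq_coe, Complex.re_ofReal_mul]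

omit [DecidableEq ι] in
/-- `Re(P (X ⊗ 1)) = Re P · X` for a real `X`. [folklore] -/
private theorem map_re_mul_ofRealHom (X : Matrix ι ι ℝ) (P : Matrix ι ι ℂ) :
    (P * X.map Complex.ofRealHom).map Complex.re = P.map Complex.re * X := by
  ext i j
  simp only [Matrix.map_apply, Matrix.mul_apply, Complex.re_sum, Complex.ofRealHom_eq_coe, Complex.re_mul_ofReal]

omit [DecidableEq ι] in
/-- `Im((X ⊗ 1) P) = X · Im P` for a real `X`. [folklore] -/
private theorem map_im_ofRealHom_mul (X : Matrix ι ι ℝ) (P : Matrix ι ι ℂ) :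
    (X.map Complex.ofRealHom * P).map Complex.im = X * P.map Complex.im := by
  ext i j
  simp only [Matrix.map_apply, Matrix.mul_apply, Complex.im_sum, Complex.ofRealHom_eq_coe, Complex.im_ofReal_mul]

omit [DecidableEq ι] in
/-- `Im(P (X ⊗ 1)) = Im P · X` for a real `X`. [folklore] -/
private theorem map_im_mul_ofRealHom (X : Matrix ι ι ℝ) (P : Matrix ι ι ℂ) :
    (P * X.map Complex.ofRealHom).map Complex.im = P.map Complex.im * X := by
  ext i j
  simp only [Matrix.map_apply, Matrix.mul_apply, Complex.im_sum, Complex.ofRealHom_eq_coe, Complex.im_mul_ofReal]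

omit [Fintype ι] in
/-- `(a • 1) ⊗ 1 + i · ((b • 1) ⊗ 1) = (a + bi) • 1`. [folklore] -/
private theorem map_smul_one_add_I_smul_map_smul_one (a b : ℝ) :
    (a • (1 : Matrix ι ι ℝ)).map Complex.ofRealHom + Complex.I • (b • (1 : Matrix ι ι ℝ)).map Complex.ofRealHom =
      ((a : ℂ) + b * Complex.I) • (1 : Matrix ι ι ℂ) := by
  ext i j
  simp only [Matrix.add_apply, Matrix.smul_apply, Matrix.map_apply, Matrix.one_apply, smul_eq_mul,
    Complex.ofRealHom_eq_coe]
  split_ifs <;> push_cast <;> ring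

/-- The realification of the rational scalar matrices is the line `ℝ · 1`. [folklore] -/
private theorem span_image_bot_le_span_one :
    Submodule.span ℝ ((fun A : Matrix ι ι ℚ ↦ A.map ((↑) : ℚ → ℝ)) '' ((⊥ : Subalgebra ℚ (Matrix ι ι ℚ)) :
      Set (Matrix ι ι ℚ))) ≤ Submodule.span ℝ {(1 : Matrix ι ι ℝ)} := by
  refine Submodule.span_le.2 ?_
  rintro _ ⟨B, hB, rfl⟩
  rw [SetLike.mem_coe, Algebra.mem_bot] at hB
  obtain ⟨q, rfl⟩ := hB
  have h1 : (algebraMap ℚ (Matrix ι ι ℚ) q).map ((↑) : ℚ → ℝ) = (q : ℝ) • (1 : Matrix ι ι ℝ) := by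
    ext i j
    rw [Matrix.map_apply, Matrix.algebraMap_matrix_apply, Matrix.smul_apply, Matrix.one_apply, smul_eq_mul, mul_ite,
      mul_one, mul_zero]
    split_ifs <;> simp
  dsimp only
  rw [SetLike.mem_coe, h1]
  exact Submodule.smul_mem _ _ (Submodule.subset_span rfl)

end LinearAlgebra

/-! ## §1 `V_ℂ` is an irreducible `𝔤`-module iff `End_ℚ(X) = ℚ` (every polarised complex torus) -/

section Irreducible

variable {ι : Type*} [Fintype ι] [DecidableEq ι] {E : Type*} [NormedAddCommGroup E] [NormedSpace ℂ E]
  {Φ : (ι → ℝ) ≃L[ℝ] E} {η : E [⋀^Fin 2]→L[ℝ] ℝ}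

/-- **`𝔤 = Lie Hg(X)(ℂ) ⊆ 𝔰𝔭(V_ℂ, E_ℂ)`**: `ᵗZ (G ⊗ 1) + (G ⊗ 1) Z = 0` for `Z ∈ 𝔤`, `G` the Gram matrix of the Riemann form
(`𝔥𝔤_ℝ ⊆ 𝔰𝔭(V, E)` — the tree's `IsRiemannForm.transpose_mul_latticeGram_add_eq_zero_of_mem_hodgeGroupLie` — across
`𝔤 = 𝔥𝔤_ℝ ⊕ i𝔥𝔤_ℝ`, `mem_hodgeGroupLieC_iff_re_im`). [cite: Lange2023AbelianVarietiesComplex, §7.2.1 Prop. 7.2.3 and §7.3.1, proof of Prop. 7.3.3 ("`Hg(X)(ℂ) = Sp(V, E)(ℂ)`")]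
[cite: GoodmanWallachGTM255, §1.7.1 (1.61)] -/
theorem IsRiemannForm.transpose_mul_map_latticeGram_add_eq_zero_of_mem_hodgeGroupLieC (hη : IsRiemannForm Φ η)
    {Z : Matrix ι ι ℂ} (hZ : Z ∈ hodgeGroupLieC Φ) :
    Zᵀ * (latticeGram Φ η).map Complex.ofRealHom + (latticeGram Φ η).map Complex.ofRealHom * Z = 0 := by
  obtain ⟨hre, him⟩ := (ComplexTorus.mem_hodgeGroupLieC_iff_re_im Φ).1 hZ
  have key : ∀ X ∈ hodgeGroupLie Φ, (X.map Complex.ofRealHom)ᵀ * (latticeGram Φ η).map Complex.ofRealHom +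
      (latticeGram Φ η).map Complex.ofRealHom * X.map Complex.ofRealHom = 0 := fun X hX ↦
    transpose_map_mul_add_eq_zero (hη.transpose_mul_latticeGram_add_eq_zero_of_mem_hodgeGroupLie hX)
  rw [← map_re_add_I_smul_map_im Z, Matrix.transpose_add, Matrix.transpose_smul, Matrix.add_mul, Matrix.mul_add,
    Matrix.smul_mul, Matrix.mul_smul, add_add_add_comm, ← smul_add, key _ hre, key _ him, smul_zero, add_zero]

/-- **IRREDUCIBILITY OF `V_ℂ` UNDER `𝔤 = Lie Hg(X)(ℂ)` WHEN `End_ℚ(X) = ℚ`** (every polarised complex torus `(X, E)`, any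
dimension): a complex subspace `U ⊆ V_ℂ = ℂ^ι` stable under `𝔤` is `0` or `V_ℂ`.  Proof: `U` is graded by `J ⊗ 1 ∈ 𝔤`;
`U† = {y | E_ℂ(y, ū) = 0 ∀ u ∈ U}` is `𝔤`-stable (`𝔤 ⊆ 𝔰𝔭(V_ℂ, E_ℂ)`, `𝔤̄ = 𝔤`) with `U ∩ U† = 0` (second Riemann bilinear
relation on `V^{0,-1}` and on `V^{-1,0} = \overline{V^{0,-1}}`) and `dim U† ≥ dim V_ℂ - dim U`, so `V_ℂ = U ⊕ U†`; the projector
onto `U` along `U†` commutes with `𝔤 ⊇ 𝔥𝔤_ℝ ⊗ 1`, so its real and imaginary parts lie in `End(V_ℝ)^{𝔥𝔤_ℝ} = End_ℚ(X) ⊗ ℝ = ℝ·1`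
("`End_ℚ(X) = End_{Hg(X)}(H_1(X,ℚ))`"): it is a scalar, hence `1`.  (The device of the tree's
`Motives.HodgeStructure.SymplecticTheta.eq_bot_or_top_of_stable`, in the period-matrix vocabulary.)
[cite: Lange2023AbelianVarietiesComplex, §7.2.2 Prop. 7.2.5 and §7.2.4 Exercise (3)] [cite: Zarhin1983HodgeGroupsK3, §2]
[cite: MoonenZarhin1999LowDim, §2 (2.2)] -/
theorem IsRiemannForm.eq_bot_or_eq_top_of_forall_mulVec_mem (hη : IsRiemannForm Φ η) (hE : endAlgRat Φ = ⊥)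
    {U : Submodule ℂ (ι → ℂ)} (hU : ∀ Z ∈ hodgeGroupLieC Φ, ∀ u ∈ U, Z *ᵥ u ∈ U) : U = ⊥ ∨ U = ⊤ := by
  classical
  -- the data: `G ⊗ 1`, `J ⊗ 1`, `ω = E_ℂ`
  have hJJ := jMatrix_mul_jMatrix Φ
  have hJG := transpose_jMatrix_mul_latticeGram_mul_jMatrix Φ hη.1
  have hGT : ((latticeGram Φ η).map Complex.ofRealHom)ᵀ = -(latticeGram Φ η).map Complex.ofRealHom := by
    rw [← Matrix.transpose_map, latticeGram_transpose, Matrix.map_neg _ (map_neg Complex.ofRealHom)]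
  set ω : LinearMap.BilinForm ℂ (ι → ℂ) := Matrix.toBilin' ((latticeGram Φ η).map Complex.ofRealHom) with hωdef
  have hω : ∀ x y, ω x y = x ⬝ᵥ ((latticeGram Φ η).map Complex.ofRealHom *ᵥ y) := fun x y ↦
    Matrix.toBilin'_apply' _ x y
  have halt : ∀ x y, ω x y = -ω y x := fun x y ↦ by
    rw [hω, hω]; exact dotProduct_mulVec_eq_neg_of_transpose_eq_neg hGT x y
  have hskew : ∀ Z ∈ hodgeGroupLieC Φ, ∀ x y, ω (Z *ᵥ x) y + ω x (Z *ᵥ y) = 0 := fun Z hZ x y ↦ by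
    rw [hω, hω]
    exact dotProduct_mulVec_add_eq_zero_of_transpose_mul_add_eq_zero
      (hη.transpose_mul_map_latticeGram_add_eq_zero_of_mem_hodgeGroupLieC hZ) x y
  -- stable subspaces are graded by `J ⊗ 1 ∈ 𝔤`
  have hJmem : (jMatrix Φ).map Complex.ofRealHom ∈ hodgeGroupLieC Φ := jMatrix_map_mem_hodgeGroupLieC Φ
  have hgraded : ∀ T : Submodule ℂ (ι → ℂ), (∀ Z ∈ hodgeGroupLieC Φ, ∀ u ∈ T, Z *ᵥ u ∈ T) → ∀ u ∈ T,
      u - Complex.I • ((jMatrix Φ).map Complex.ofRealHom *ᵥ u) ∈ T ∧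
        u + Complex.I • ((jMatrix Φ).map Complex.ofRealHom *ᵥ u) ∈ T := fun T hT u hu ↦
    ⟨T.sub_mem hu (T.smul_mem _ (hT _ hJmem u hu)), T.add_mem hu (T.smul_mem _ (hT _ hJmem u hu))⟩
  by_cases hU0 : U = ⊥
  · exact Or.inl hU0
  right
  obtain ⟨u₀, hu₀U, hu₀0⟩ := (Submodule.ne_bot_iff U).1 hU0
  -- `U† = {y | E_ℂ(y, ū) = 0 ∀ u ∈ U}`
  set Ud : Submodule ℂ (ι → ℂ) := ⨅ u : U, LinearMap.ker (ω.flip (star (u : ι → ℂ))) with hUddef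
  have hmemUd : ∀ y, y ∈ Ud ↔ ∀ u ∈ U, ω y (star u) = 0 := fun y ↦ by
    simp only [hUddef, Submodule.mem_iInf, LinearMap.mem_ker, Subtype.forall]
    exact Iff.rfl
  have hXUd : ∀ Z ∈ hodgeGroupLieC Φ, ∀ y ∈ Ud, Z *ᵥ y ∈ Ud := by
    intro Z hZ y hy
    rw [hmemUd] at hy ⊢
    intro u hu
    have h := hskew Z hZ y (star u)
    rwa [mulVec_star_eq_star_map_conj_mulVec, hy _ (hU _ (map_conj_mem_hodgeGroupLieC Φ hZ) u hu), add_zero] at h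
  -- `U ∩ U† = 0`: the second Riemann bilinear relation on the graded pieces
  have hHR : ∀ z ∈ U, z ∈ Ud →
      (z ∈ hodgeFiltration (jMatrix Φ) ∨ z ∈ hodgeFiltrationConj (jMatrix Φ)) → z = 0 := by
    intro z hz hzd hpiece
    by_contra hz0
    have h0 : ω z (star z) = 0 := (hmemUd z).1 hzd z hz
    rcases hpiece with hF | hFc
    · have hpos := I_mul_star_dotProduct_mulVec_pos_of_mem_hodgeFiltration hJJ hJG hη.posDef_hodgeFormR hF hz0
      rw [halt, neg_eq_zero, hω] at h0
      rw [h0, mul_zero] at hpos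
      exact lt_irrefl _ hpos
    · have hF : star z ∈ hodgeFiltration (jMatrix Φ) := star_mem_hodgeFiltration_iff.2 hFc
      have hpos := I_mul_star_dotProduct_mulVec_pos_of_mem_hodgeFiltration hJJ hJG hη.posDef_hodgeFormR hF
        (star_ne_zero.2 hz0)
      rw [hω] at h0
      rw [star_star, h0, mul_zero] at hpos
      exact lt_irrefl _ hpos
  have hUUd : ∀ u ∈ U, u ∈ Ud → u = 0 := by
    intro u hu hud
    have h1 := hHR _ (hgraded U hU u hu).1 (hgraded Ud hXUd u hud).1
      (Or.inr (sub_I_smul_mulVec_mem_hodgeFiltrationConj hJJ u))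
    have h2 := hHR _ (hgraded U hU u hu).2 (hgraded Ud hXUd u hud).2
      (Or.inl (add_I_smul_mulVec_mem_hodgeFiltration hJJ u))
    have h : (2 : ℂ) • u = (u - Complex.I • ((jMatrix Φ).map Complex.ofRealHom *ᵥ u)) +
        (u + Complex.I • ((jMatrix Φ).map Complex.ofRealHom *ᵥ u)) := by
      rw [two_smul]; abel
    rw [h1, h2, add_zero, smul_eq_zero] at h
    exact h.resolve_left two_ne_zero
  -- `dim V_ℂ ≤ dim U + dim U†`
  have hdim : Fintype.card ι ≤ finrank ℂ U + finrank ℂ Ud := by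
    set b := Module.finBasis ℂ U with hbdef
    set f : (ι → ℂ) →ₗ[ℂ] (Fin (finrank ℂ U) → ℂ) :=
      LinearMap.pi fun i ↦ ω.flip (star (b i : ι → ℂ)) with hfdef
    have hf : ∀ w i, f w i = ω w (star (b i : ι → ℂ)) := fun w i ↦ rfl
    have hker : LinearMap.ker f ≤ Ud := by
      intro w hw
      rw [LinearMap.mem_ker] at hw
      rw [hmemUd]
      intro u hu
      have hu' : u = ∑ i, b.repr ⟨u, hu⟩ i • (b i : ι → ℂ) := by
        have h := congrArg Subtype.val (b.sum_repr ⟨u, hu⟩).symm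
        simpa only [Submodule.coe_sum, Submodule.coe_smul] using h
      rw [hu', star_sum, map_sum]
      refine Finset.sum_eq_zero fun i _ ↦ ?_
      have hi := congrFun hw i
      rw [Pi.zero_apply, hf] at hi
      rw [star_smul, map_smul, smul_eq_mul, hi, mul_zero]
    have h1 := LinearMap.finrank_range_add_finrank_ker f
    have h2 : finrank ℂ (LinearMap.range f) ≤ finrank ℂ U :=
      (Submodule.finrank_le _).trans (Module.finrank_fin_fun ℂ).le
    have h3 : finrank ℂ (LinearMap.ker f) ≤ finrank ℂ Ud := Submodule.finrank_mono hker
    rw [Module.finrank_fintype_fun_eq_card] at h1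
    omega
  -- `V_ℂ = U ⊕ U†`
  have h0 : U ⊓ Ud = ⊥ := by
    rw [eq_bot_iff]
    intro u hu
    rw [Submodule.mem_bot]
    exact hUUd u hu.1 hu.2
  have hsup : U ⊔ Ud = ⊤ := by
    refine Submodule.eq_top_of_finrank_eq ?_
    have h := Submodule.finrank_sup_add_finrank_inf_eq U Ud
    rw [h0, finrank_bot, add_zero] at h
    have h' := Submodule.finrank_le (U ⊔ Ud)
    rw [Module.finrank_fintype_fun_eq_card] at h' ⊢
    omega
  have hc : IsCompl U Ud := ⟨disjoint_iff.2 h0, codisjoint_iff.2 hsup⟩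
  -- the projector onto `U` along `U†` commutes with `𝔤`
  set π := U.projection Ud hc with hπ
  have hπcomm : ∀ Z ∈ hodgeGroupLieC Φ, ∀ x, π (Z *ᵥ x) = Z *ᵥ π x := by
    intro Z hZ x
    have hx : x = π x + (x - π x) := by abel
    have h1 : π x ∈ U := Submodule.projection_apply_mem hc x
    have h2 : Z *ᵥ (x - π x) ∈ Ud := hXUd Z hZ _ (Submodule.sub_projection_mem hc x)
    conv_lhs => rw [hx]
    rw [Matrix.mulVec_add, map_add, Submodule.projection_apply_of_mem_left hc (hU Z hZ _ h1),
      (Submodule.projection_apply_eq_zero_iff hc).2 h2, add_zero]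
  -- its matrix commutes with `𝔥𝔤_ℝ ⊗ 1`, so its real and imaginary parts are real scalars
  set P : Matrix ι ι ℂ := LinearMap.toMatrix' π with hPdef
  have hPv : ∀ v, P *ᵥ v = π v := fun v ↦ by rw [hPdef, ← Matrix.toLin'_apply, Matrix.toLin'_toMatrix']
  have hPcomm : ∀ Z ∈ hodgeGroupLieC Φ, Z * P = P * Z := fun Z hZ ↦ by
    refine Matrix.toLin'.injective (LinearMap.ext fun v ↦ ?_)
    rw [Matrix.toLin'_apply, Matrix.toLin'_apply, ← Matrix.mulVec_mulVec, ← Matrix.mulVec_mulVec, hPv, hPv,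
      hπcomm Z hZ]
  have hscalar : ∀ Y : Matrix ι ι ℝ, (∀ X ∈ hodgeGroupLie Φ, X * Y = Y * X) → ∃ c : ℝ, Y = c • 1 := by
    intro Y hY
    have hmem := (forall_hodgeGroupLie_comm_iff_mem_span_endAlgRat Φ).1 hY
    rw [hE] at hmem
    obtain ⟨c, hc⟩ := Submodule.mem_span_singleton.1 (span_image_bot_le_span_one hmem)
    exact ⟨c, hc.symm⟩
  have hre : ∀ X ∈ hodgeGroupLie Φ, X * P.map Complex.re = P.map Complex.re * X := fun X hX ↦ by
    have h := congrArg (fun M : Matrix ι ι ℂ ↦ M.map Complex.re) (hPcomm _ ((mem_hodgeGroupLie_iff_map_mem Φ).1 hX))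
    simpa only [map_re_ofRealHom_mul, map_re_mul_ofRealHom] using h
  have him : ∀ X ∈ hodgeGroupLie Φ, X * P.map Complex.im = P.map Complex.im * X := fun X hX ↦ by
    have h := congrArg (fun M : Matrix ι ι ℂ ↦ M.map Complex.im) (hPcomm _ ((mem_hodgeGroupLie_iff_map_mem Φ).1 hX))
    simpa only [map_im_ofRealHom_mul, map_im_mul_ofRealHom] using h
  obtain ⟨a, ha⟩ := hscalar _ hre
  obtain ⟨b, hb⟩ := hscalar _ him
  have hPeq : P = ((a : ℂ) + b * Complex.I) • (1 : Matrix ι ι ℂ) := by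
    rw [← map_re_add_I_smul_map_im P, ha, hb, map_smul_one_add_I_smul_map_smul_one]
  have hπα : ∀ v, π v = ((a : ℂ) + b * Complex.I) • v := fun v ↦ by
    rw [← hPv, hPeq, Matrix.smul_mulVec, Matrix.one_mulVec]
  -- the scalar is `1` (`U ≠ 0`), so `U = V_ℂ`
  have hα : ((a : ℂ) + b * Complex.I) = 1 := by
    have h : π u₀ = u₀ := Submodule.projection_apply_of_mem_left hc hu₀U
    rw [hπα] at h
    have h' : (((a : ℂ) + b * Complex.I) - 1) • u₀ = 0 := by rw [sub_smul, one_smul, h, sub_self]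
    exact sub_eq_zero.1 ((smul_eq_zero.1 h').resolve_right hu₀0)
  rw [eq_top_iff]
  intro w _
  have h : π w ∈ U := Submodule.projection_apply_mem hc w
  rwa [hπα, hα, one_smul] at h

omit [Fintype ι] [DecidableEq ι] in
/-- `(A ⊗_ℚ ℝ) ⊗_ℝ ℂ = A ⊗_ℚ ℂ` for a rational matrix. [folklore] -/
private theorem map_ratCast_map_ofRealHom₄₇ (A : Matrix ι ι ℚ) :
    (A.map ((↑) : ℚ → ℝ)).map Complex.ofRealHom = A.map ((↑) : ℚ → ℂ) := by
  rw [Matrix.map_map]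
  exact congrArg A.map (funext fun q ↦ Complex.ofReal_ratCast q)

/-- **`End_ℚ(X)` commutes with `𝔤 = Lie Hg(X)(ℂ)`** (Prop. 7.2.5 infinitesimally, across `𝔤 = 𝔥𝔤_ℝ ⊕ i𝔥𝔤_ℝ`; every complex torus).
[cite: Lange2023AbelianVarietiesComplex, §7.2.2 Prop. 7.2.5] [cite: GoodmanWallachGTM255, §1.7.1 (1.61)] -/
theorem map_ratCast_comm_of_mem_endAlgRat_of_mem_hodgeGroupLieC {A : Matrix ι ι ℚ} (hA : A ∈ endAlgRat Φ)
    {Z : Matrix ι ι ℂ} (hZ : Z ∈ hodgeGroupLieC Φ) : A.map ((↑) : ℚ → ℂ) * Z = Z * A.map ((↑) : ℚ → ℂ) := by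
  obtain ⟨hre, him⟩ := (mem_hodgeGroupLieC_iff_re_im Φ).1 hZ
  have key : ∀ X ∈ hodgeGroupLie Φ, A.map ((↑) : ℚ → ℂ) * X.map Complex.ofRealHom =
      X.map Complex.ofRealHom * A.map ((↑) : ℚ → ℂ) := fun X hX ↦ by
    have h := congrArg (fun M : Matrix ι ι ℝ ↦ M.map Complex.ofRealHom) (map_ratCast_comm_of_mem_endAlgRat hA hX)
    simpa only [Matrix.map_mul, map_ratCast_map_ofRealHom₄₇] using h
  rw [← map_re_add_I_smul_map_im Z, Matrix.mul_add, Matrix.add_mul, Matrix.mul_smul, Matrix.smul_mul, key _ hre,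
    key _ him]

/-- **CONVERSELY, IRREDUCIBILITY OF `V_ℂ` UNDER `𝔤` FORCES `End_ℚ(X) = ℚ`** (every complex torus): an endomorphism
commutes with `𝔤`, so each complex eigenspace of it is `𝔤`-stable, hence all of `V_ℂ` — the endomorphism is a (rational) scalar.
[cite: Lange2023AbelianVarietiesComplex, §7.2.2 Prop. 7.2.5 and §7.2.4 Exercise (3)] -/
theorem endAlgRat_eq_bot_of_forall_eq_bot_or_eq_top
    (hirr : ∀ U : Submodule ℂ (ι → ℂ), (∀ Z ∈ hodgeGroupLieC Φ, ∀ u ∈ U, Z *ᵥ u ∈ U) → U = ⊥ ∨ U = ⊤) :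
    endAlgRat Φ = ⊥ := by
  classical
  refine eq_bot_iff.2 fun A hA ↦ ?_
  rcases isEmpty_or_nonempty ι with hι | hι
  · rw [Subsingleton.elim A 0]
    exact (⊥ : Subalgebra ℚ (Matrix ι ι ℚ)).zero_mem
  obtain ⟨i₀⟩ := id hι
  have hcomm : ∀ Z ∈ hodgeGroupLieC Φ, Z * A.map ((↑) : ℚ → ℂ) = A.map ((↑) : ℚ → ℂ) * Z := fun Z hZ ↦
    (map_ratCast_comm_of_mem_endAlgRat_of_mem_hodgeGroupLieC hA hZ).symm
  obtain ⟨μ, hμ⟩ := Module.End.exists_eigenvalue (Matrix.toLin' (A.map ((↑) : ℚ → ℂ)))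
  have hstab : ∀ Z ∈ hodgeGroupLieC Φ, ∀ u ∈ Module.End.eigenspace (Matrix.toLin' (A.map ((↑) : ℚ → ℂ))) μ,
      Z *ᵥ u ∈ Module.End.eigenspace (Matrix.toLin' (A.map ((↑) : ℚ → ℂ))) μ := fun Z hZ u hu ↦ by
    rw [Module.End.mem_eigenspace_iff, Matrix.toLin'_apply] at hu ⊢
    rw [Matrix.mulVec_mulVec, ← hcomm Z hZ, ← Matrix.mulVec_mulVec, hu, Matrix.mulVec_smul]
  have htop := (hirr _ hstab).resolve_left (Module.End.hasEigenvalue_iff.1 hμ)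
  have hAv : ∀ v, A.map ((↑) : ℚ → ℂ) *ᵥ v = μ • v := fun v ↦ by
    have hv : v ∈ Module.End.eigenspace (Matrix.toLin' (A.map ((↑) : ℚ → ℂ))) μ := htop ▸ Submodule.mem_top
    rwa [Module.End.mem_eigenspace_iff, Matrix.toLin'_apply] at hv
  have hAeq : A.map ((↑) : ℚ → ℂ) = μ • (1 : Matrix ι ι ℂ) :=
    Matrix.toLin'.injective (LinearMap.ext fun v ↦ by
      rw [Matrix.toLin'_apply, Matrix.toLin'_apply, hAv, Matrix.smul_mulVec, Matrix.one_mulVec])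
  have hent : ∀ i j, ((A i j : ℚ) : ℂ) = μ * (1 : Matrix ι ι ℂ) i j := fun i j ↦ by
    have h := congrFun (congrFun hAeq i) j
    rwa [Matrix.map_apply, Matrix.smul_apply, smul_eq_mul] at h
  have hq : μ = ((A i₀ i₀ : ℚ) : ℂ) := by rw [hent, Matrix.one_apply_eq, mul_one]
  have hA' : A = algebraMap ℚ (Matrix ι ι ℚ) (A i₀ i₀) := by
    ext i j
    apply Rat.cast_injective (α := ℂ)
    rw [hent, hq, Matrix.algebraMap_matrix_apply, Matrix.one_apply]
    split_ifs <;> simp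
  rw [hA']
  exact Subalgebra.algebraMap_mem _ _

/-- **`V_ℂ` is `𝔤`-IRREDUCIBLE ⟺ `End_ℚ(X) = ℚ`** for a polarised complex torus — Schur's lemma on both sides of
"`End_ℚ(X) = End_{Hg(X)}(H_1(X,ℚ))`". [cite: Lange2023AbelianVarietiesComplex, §7.2.4 Exercise (3) and §7.2.2 Prop. 7.2.5]
[cite: Zarhin1983HodgeGroupsK3, §2] -/
theorem IsRiemannForm.forall_eq_bot_or_eq_top_iff_endAlgRat_eq_bot (hη : IsRiemannForm Φ η) :
    (∀ U : Submodule ℂ (ι → ℂ), (∀ Z ∈ hodgeGroupLieC Φ, ∀ u ∈ U, Z *ᵥ u ∈ U) → U = ⊥ ∨ U = ⊤) ↔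
      endAlgRat Φ = ⊥ :=
  ⟨endAlgRat_eq_bot_of_forall_eq_bot_or_eq_top, fun hE _ hU ↦ hη.eq_bot_or_eq_top_of_forall_mulVec_mem hE hU⟩

/-- The `IsAbelianVariety` form: for an abelian variety, `V_ℂ` is `Lie Hg(X)(ℂ)`-irreducible iff `End_ℚ(X) = ℚ`.
[cite: Lange2023AbelianVarietiesComplex, §7.2.4 Exercise (3) and §7.2.2 Prop. 7.2.5] -/
theorem IsAbelianVariety.forall_eq_bot_or_eq_top_iff_endAlgRat_eq_bot (hX : IsAbelianVariety Φ) :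
    (∀ U : Submodule ℂ (ι → ℂ), (∀ Z ∈ hodgeGroupLieC Φ, ∀ u ∈ U, Z *ᵥ u ∈ U) → U = ⊥ ∨ U = ⊤) ↔
      endAlgRat Φ = ⊥ := by
  obtain ⟨η, hη⟩ := hX
  exact hη.forall_eq_bot_or_eq_top_iff_endAlgRat_eq_bot

end Irreducible

/-! ## §2 The theorem: for `g = 2` and `End_ℚ(X) = ℚ`, `𝔤 ⊇ 𝔰𝔭(V_ℂ, E_ℂ)` and `Hg(X) = Sp(V, E)` -/

section Surface

variable {ι : Type*} [Fintype ι] [DecidableEq ι] {E : Type*} [NormedAddCommGroup E] [NormedSpace ℂ E]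
  {Φ : (ι → ℝ) ≃L[ℝ] E} {η : E [⋀^Fin 2]→L[ℝ] ℝ}

/-- **THE LIE STEP OF MOONEN–ZARHIN (2.2), TYPE I(1): `𝔰𝔭(V_ℂ, E_ℂ) ⊆ 𝔤 = Lie Hg(X)(ℂ)`** for a polarised complex torus of
dimension `2` with `End_ℚ(X) = ℚ` — every complex matrix `Z` with `ᵗZ (G ⊗ 1) + (G ⊗ 1) Z = 0` lies in `𝔤`.  Proof: `V_ℂ` is
`𝔤`-irreducible (§1); the core theorem `SymplecticTheta.core_of_irreducible` for the involution `T = -i(J ⊗ 1) ∈ 𝔤`, whose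
eigenspaces `V^{-1,0}`, `V^{0,-1}` are planes (`g = 2`), and for `-T`, puts `𝔲⁺ ⊕ 𝔤𝔩(V^{-1,0}) ⊕ 𝔲⁻ ⊆ 𝔤`; a skew `Z` is
`Z₋ + Z₀ + Z₊` along `ad T` (`SymplecticTheta.exists_decomp`). [cite: MoonenZarhin1999LowDim, §2 (2.2) ("Type I(1) … `Hg(X) = Sp(V,φ) ≅ Sp_{4,ℚ}`")]
[cite: GoodmanWallachGTM255, §2.1.2] -/
theorem IsRiemannForm.mem_hodgeGroupLieC_of_transpose_mul_add_eq_zero_of_finrank_eq_two [FiniteDimensional ℂ E]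
    (hη : IsRiemannForm Φ η) (h2 : finrank ℂ E = 2) (hE : endAlgRat Φ = ⊥) {Z : Matrix ι ι ℂ}
    (hZ : Zᵀ * (latticeGram Φ η).map Complex.ofRealHom + (latticeGram Φ η).map Complex.ofRealHom * Z = 0) :
    Z ∈ hodgeGroupLieC Φ := by
  classical
  letI : LieRing (Matrix ι ι ℂ) := LieRing.ofAssociativeRing
  -- the form `ω = E_ℂ` on `M = ℂ^ι`
  have hJJ := jMatrix_mul_jMatrix Φ
  have hGT : ((latticeGram Φ η).map Complex.ofRealHom)ᵀ = -(latticeGram Φ η).map Complex.ofRealHom := by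
    rw [← Matrix.transpose_map, latticeGram_transpose, Matrix.map_neg _ (map_neg Complex.ofRealHom)]
  set ω : LinearMap.BilinForm ℂ (ι → ℂ) := Matrix.toBilin' ((latticeGram Φ η).map Complex.ofRealHom) with hωdef
  have hω : ∀ x y, ω x y = x ⬝ᵥ ((latticeGram Φ η).map Complex.ofRealHom *ᵥ y) := fun x y ↦
    Matrix.toBilin'_apply' _ x y
  have hωnd : ω.Nondegenerate := by
    refine LinearMap.BilinForm.nondegenerate_toBilin'_iff_det_ne_zero.2 ?_
    rw [← RingHom.mapMatrix_apply, ← RingHom.map_det]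
    exact Complex.ofReal_ne_zero.2 hη.isUnit_det_latticeGram.ne_zero
  have hωalt : ∀ x y, ω x y = -ω y x := fun x y ↦ by
    rw [hω, hω]; exact dotProduct_mulVec_eq_neg_of_transpose_eq_neg hGT x y
  -- `𝔊 = 𝔤`, transported to `End(ℂ^ι)` along `Matrix.toLin'`
  set 𝔊 : Submodule ℂ (Module.End ℂ (ι → ℂ)) :=
    (hodgeGroupComplexLie Φ).toSubmodule.comap
      (LinearMap.toMatrix' : Module.End ℂ (ι → ℂ) ≃ₗ[ℂ] Matrix ι ι ℂ).toLinearMap with h𝔊def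
  have hmem𝔊 : ∀ Y : Module.End ℂ (ι → ℂ), Y ∈ 𝔊 ↔ LinearMap.toMatrix' Y ∈ hodgeGroupLieC Φ := fun Y ↦ by
    rw [h𝔊def, Submodule.mem_comap, LinearEquiv.coe_coe, LieSubalgebra.mem_toSubmodule,
      mem_hodgeGroupComplexLie_iff_mem_hodgeGroupLieC]
  have htoLin : ∀ M : Matrix ι ι ℂ, Matrix.toLin' M ∈ 𝔊 ↔ M ∈ hodgeGroupLieC Φ := fun M ↦ by
    rw [hmem𝔊, LinearMap.toMatrix'_toLin']
  have hYv : ∀ (Y : Module.End ℂ (ι → ℂ)) (v : ι → ℂ), Y v = LinearMap.toMatrix' Y *ᵥ v := fun Y v ↦ by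
    conv_lhs => rw [← Matrix.toLin'_toMatrix' Y]
    rw [Matrix.toLin'_apply]
  have hbr : ∀ Y ∈ 𝔊, ∀ Y' ∈ 𝔊, Y * Y' - Y' * Y ∈ 𝔊 := fun Y hY Y' hY' ↦ by
    rw [hmem𝔊] at hY hY' ⊢
    rw [map_sub, LinearMap.toMatrix'_mul, LinearMap.toMatrix'_mul, ← Ring.lie_def]
    exact (hodgeGroupLieC Φ).lie_mem hY hY'
  have hskew : ∀ Y ∈ 𝔊, ∀ x y, ω (Y x) y + ω x (Y y) = 0 := fun Y hY x y ↦ by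
    rw [hω, hω, hYv, hYv]
    exact dotProduct_mulVec_add_eq_zero_of_transpose_mul_add_eq_zero
      (hη.transpose_mul_map_latticeGram_add_eq_zero_of_mem_hodgeGroupLieC ((hmem𝔊 Y).1 hY)) x y
  -- the involution `T = -i(J ⊗ 1) ∈ 𝔊`: `+1` on `V^{-1,0} = F̄⁰`, `-1` on `V^{0,-1} = F⁰`
  set T : Module.End ℂ (ι → ℂ) := Matrix.toLin' ((-Complex.I) • (jMatrix Φ).map Complex.ofRealHom) with hTdef
  have hTv : ∀ v, T v = -(Complex.I • ((jMatrix Φ).map Complex.ofRealHom *ᵥ v)) := fun v ↦ by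
    rw [hTdef, Matrix.toLin'_apply, Matrix.smul_mulVec, neg_smul]
  have hT𝔊 : T ∈ 𝔊 := by
    rw [hmem𝔊, hTdef, LinearMap.toMatrix'_toLin']
    exact ComplexTorus.smul_mem_hodgeGroupLieC Φ (jMatrix_map_mem_hodgeGroupLieC Φ) _
  have hJJv : ∀ v : ι → ℂ, (jMatrix Φ).map Complex.ofRealHom *ᵥ ((jMatrix Φ).map Complex.ofRealHom *ᵥ v) = -v :=
    map_ofRealHom_mulVec_mulVec_of_mul_self hJJ
  have hTT : ∀ v, T (T v) = v := fun v ↦ by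
    rw [hTv, hTv, Matrix.mulVec_neg, Matrix.mulVec_smul, hJJv]
    simp only [smul_neg, neg_neg, smul_smul, Complex.I_mul_I, neg_smul, one_smul]
  have hP : ∀ x ∈ hodgeFiltrationConj (jMatrix Φ), T x = x := fun x hx ↦ by
    rw [hTv, mem_hodgeFiltrationConj_iff.1 hx, smul_smul, Complex.I_mul_I, neg_smul, one_smul, neg_neg]
  have hQ : ∀ x ∈ hodgeFiltration (jMatrix Φ), T x = -x := fun x hx ↦ by
    rw [hTv, mem_hodgeFiltration_iff.1 hx, smul_neg, smul_smul, Complex.I_mul_I, neg_smul, one_smul, neg_neg]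
  have hPmem : ∀ v, (2 : ℂ)⁻¹ • (v + T v) ∈ hodgeFiltrationConj (jMatrix Φ) := fun v ↦ by
    rw [hTv, ← sub_eq_add_neg]
    exact Submodule.smul_mem _ _ (sub_I_smul_mulVec_mem_hodgeFiltrationConj hJJ v)
  have hQmem : ∀ v, (2 : ℂ)⁻¹ • (v - T v) ∈ hodgeFiltration (jMatrix Φ) := fun v ↦ by
    rw [hTv, sub_neg_eq_add]
    exact Submodule.smul_mem _ _ (add_I_smul_mulVec_mem_hodgeFiltration hJJ v)
  -- `g = 2`: the two pieces are planes
  have hQ2 : finrank ℂ (hodgeFiltration (jMatrix Φ)) = 2 := by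
    have h := two_mul_finrank_hodgeFiltration hJJ
    rw [card_eq_two_mul_finrank Φ, h2] at h
    omega
  have hP2 : finrank ℂ (hodgeFiltrationConj (jMatrix Φ)) = 2 := by rw [finrank_hodgeFiltrationConj_eq, hQ2]
  -- irreducibility (§1)
  have hirr : ∀ U : Submodule ℂ (ι → ℂ), (∀ Y ∈ 𝔊, ∀ u ∈ U, Y u ∈ U) → U = ⊥ ∨ U = ⊤ := fun U hU ↦
    hη.eq_bot_or_eq_top_of_forall_mulVec_mem hE fun M hM u hu ↦ by
      have h := hU (Matrix.toLin' M) ((htoLin M).2 hM) u hu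
      rwa [Matrix.toLin'_apply] at h
  -- the core theorem for `T` and for `-T`
  obtain ⟨hA, hB⟩ := HodgeStructure.SymplecticTheta.core_of_irreducible ω hωnd hωalt 𝔊 hbr hskew hT𝔊 hTT
    (P := hodgeFiltrationConj (jMatrix Φ)) (Q := hodgeFiltration (jMatrix Φ)) hP hQ hPmem hQmem hP2 hQ2 hirr
  have hnT𝔊 : -T ∈ 𝔊 := 𝔊.neg_mem hT𝔊
  have hnTT : ∀ v, (-T) ((-T) v) = v := fun v ↦ by
    rw [LinearMap.neg_apply, LinearMap.neg_apply, map_neg, neg_neg, hTT]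
  have hP' : ∀ x ∈ hodgeFiltration (jMatrix Φ), (-T) x = x := fun x hx ↦ by
    rw [LinearMap.neg_apply, hQ x hx, neg_neg]
  have hQ' : ∀ x ∈ hodgeFiltrationConj (jMatrix Φ), (-T) x = -x := fun x hx ↦ by
    rw [LinearMap.neg_apply, hP x hx]
  have hPmem' : ∀ v, (2 : ℂ)⁻¹ • (v + (-T) v) ∈ hodgeFiltration (jMatrix Φ) := fun v ↦ by
    rw [LinearMap.neg_apply, ← sub_eq_add_neg]; exact hQmem v
  have hQmem' : ∀ v, (2 : ℂ)⁻¹ • (v - (-T) v) ∈ hodgeFiltrationConj (jMatrix Φ) := fun v ↦ by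
    rw [LinearMap.neg_apply, sub_neg_eq_add]; exact hPmem v
  obtain ⟨hA', -⟩ := HodgeStructure.SymplecticTheta.core_of_irreducible ω hωnd hωalt 𝔊 hbr hskew hnT𝔊 hnTT
    (P := hodgeFiltration (jMatrix Φ)) (Q := hodgeFiltrationConj (jMatrix Φ)) hP' hQ' hPmem' hQmem' hQ2 hP2 hirr
  -- the Lie algebra `𝔰 = 𝔰𝔭(V_ℂ, E_ℂ)` of `ω`-skew operators and the grading of `Z` along `ad T`
  let 𝔰 : Submodule ℂ (Module.End ℂ (ι → ℂ)) :=
    { carrier := {Y | ∀ x y, ω (Y x) y + ω x (Y y) = 0}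
      zero_mem' := fun x y ↦ by simp
      add_mem' := by
        intro Y Y' hY hY' x y
        simp only [LinearMap.add_apply, map_add]
        have h1 := hY x y
        have h2 := hY' x y
        linear_combination h1 + h2
      smul_mem' := by
        intro c Y hY x y
        simp only [LinearMap.smul_apply, map_smul, smul_eq_mul]
        have h1 := hY x y
        linear_combination c * h1 }
  have hmem𝔰 : ∀ Y, Y ∈ 𝔰 ↔ ∀ x y, ω (Y x) y + ω x (Y y) = 0 := fun Y ↦ Iff.rfl
  have h𝔰br : ∀ Y ∈ 𝔰, ∀ Y' ∈ 𝔰, Y * Y' - Y' * Y ∈ 𝔰 := fun Y hY Y' hY' ↦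
    (hmem𝔰 _).2 (skew_commutator₄₇ ω ((hmem𝔰 Y).1 hY) ((hmem𝔰 Y').1 hY'))
  have hT𝔰 : T ∈ 𝔰 := (hmem𝔰 T).2 (hskew T hT𝔊)
  have hZ𝔰 : Matrix.toLin' Z ∈ 𝔰 := (hmem𝔰 _).2 fun x y ↦ by
    rw [hω, hω, Matrix.toLin'_apply, Matrix.toLin'_apply]
    exact dotProduct_mulVec_add_eq_zero_of_transpose_mul_add_eq_zero hZ x y
  obtain ⟨Ym, hYm, Y0, hY0, Yp, hYp, hYeq, hYpP, hYpim, hYmQ, hYmim, -, -, hY0P, hY0Q⟩ :=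
    HodgeStructure.SymplecticTheta.exists_decomp 𝔰 h𝔰br hT𝔰 hTT (P := hodgeFiltrationConj (jMatrix Φ))
      (Q := hodgeFiltration (jMatrix Φ)) hP hQ hPmem hQmem hZ𝔰
  have hmem : Matrix.toLin' Z ∈ 𝔊 := by
    rw [hYeq]
    refine 𝔊.add_mem (𝔊.add_mem ?_ ?_) ?_
    · exact hA' Ym ((hmem𝔰 Ym).1 hYm) hYmQ hYmim
    · exact hB Y0 ((hmem𝔰 Y0).1 hY0) hY0P hY0Q
    · exact hA Yp ((hmem𝔰 Yp).1 hYp) hYpP hYpim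
  exact (htoLin Z).1 hmem

/-- **MOONEN–ZARHIN (2.2), TYPE I(1): an abelian surface with `End_ℚ(X) = ℚ` is Hodge-general, `Hg(X) = Sp(V, E)`** —
for every polarised complex torus `(X, E)` of dimension `2` with `End_ℚ(X) = ℚ` ("Type I(1): `X` is an abelian surface
with `End⁰(X) = ℚ`. Then `Hg(X) = Sp(V,φ) ≅ Sp_{4,ℚ}`"): `𝔰𝔭(V, E) ⊆ 𝔥𝔤_ℝ` by the Lie step and the tree's criterion
`Hg(X) = Sp(V, E) ⟺ 𝔰𝔭(V, E) ⊆ 𝔥𝔤_ℝ`. [cite: MoonenZarhin1999LowDim, §2 (2.2)]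
[cite: Lange2023AbelianVarietiesComplex, §7.3.1, proof of Prop. 7.3.2 (pp. 337–338)] -/
theorem IsRiemannForm.hodgeGroup_eq_spGroup_of_finrank_eq_two_of_endAlgRat_eq_bot [FiniteDimensional ℂ E]
    (hη : IsRiemannForm Φ η) (h2 : finrank ℂ E = 2) (hE : endAlgRat Φ = ⊥) : hodgeGroup Φ = spGroup Φ η :=
  hη.hodgeGroup_eq_spGroup_iff_forall_mem_hodgeGroupLie.2 fun _ hX ↦ (mem_hodgeGroupLie_iff_map_mem Φ).2
    (hη.mem_hodgeGroupLieC_of_transpose_mul_add_eq_zero_of_finrank_eq_two h2 hE (transpose_map_mul_add_eq_zero hX))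

/-- **For abelian surfaces, `Hg(X) = Sp(V, E) ⟺ End_ℚ(X) = ℚ`** (polarised complex torus of dimension `2`; `⟸` is Type I(1),
`⟹` is Schur — the tree's `IsRiemannForm.endAlgRat_eq_bot_of_hodgeGroup_eq_spGroup`). [cite: MoonenZarhin1999LowDim, §2 (2.2)]
[cite: Lange2023AbelianVarietiesComplex, §7.2.2 Prop. 7.2.5 and §7.3.1 Prop. 7.3.2–7.3.3] -/
theorem IsRiemannForm.hodgeGroup_eq_spGroup_iff_endAlgRat_eq_bot_of_finrank_eq_two [FiniteDimensional ℂ E]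
    (hη : IsRiemannForm Φ η) (h2 : finrank ℂ E = 2) : hodgeGroup Φ = spGroup Φ η ↔ endAlgRat Φ = ⊥ :=
  ⟨hη.endAlgRat_eq_bot_of_hodgeGroup_eq_spGroup, hη.hodgeGroup_eq_spGroup_of_finrank_eq_two_of_endAlgRat_eq_bot h2⟩

/-- The `IsAbelianVariety` form: **an abelian surface with `End_ℚ(X) = ℚ` has `Hg(X) = Sp(V, E)` for EVERY polarisation `E`.**
[cite: MoonenZarhin1999LowDim, §2 (2.2)] [cite: Lange2023AbelianVarietiesComplex, §7.3.1, proof of Prop. 7.3.2] -/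
theorem forall_hodgeGroup_eq_spGroup_of_finrank_eq_two_of_endAlgRat_eq_bot [FiniteDimensional ℂ E]
    (h2 : finrank ℂ E = 2) (hE : endAlgRat Φ = ⊥) :
    ∀ η : E [⋀^Fin 2]→L[ℝ] ℝ, IsRiemannForm Φ η → hodgeGroup Φ = spGroup Φ η := fun _ hη ↦
  hη.hodgeGroup_eq_spGroup_of_finrank_eq_two_of_endAlgRat_eq_bot h2 hE

/-- **An abelian surface is Hodge-general (for some, equivalently every, polarisation) iff `End_ℚ(X) = ℚ`.**
[cite: MoonenZarhin1999LowDim, §2 (2.2)] [cite: Lange2023AbelianVarietiesComplex, §7.3.1 Prop. 7.3.2–7.3.3] -/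
theorem IsAbelianVariety.exists_hodgeGroup_eq_spGroup_iff_endAlgRat_eq_bot_of_finrank_eq_two [FiniteDimensional ℂ E]
    (hX : IsAbelianVariety Φ) (h2 : finrank ℂ E = 2) :
    (∃ η : E [⋀^Fin 2]→L[ℝ] ℝ, IsRiemannForm Φ η ∧ hodgeGroup Φ = spGroup Φ η) ↔ endAlgRat Φ = ⊥ := by
  obtain ⟨η₀, hη₀⟩ := hX
  exact ⟨fun ⟨_, hη, h⟩ ↦ hη.endAlgRat_eq_bot_of_hodgeGroup_eq_spGroup h,
    fun hE ↦ ⟨η₀, hη₀, hη₀.hodgeGroup_eq_spGroup_of_finrank_eq_two_of_endAlgRat_eq_bot h2 hE⟩⟩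

end Surface

/-! ## §3 Consequences by name: `𝔥𝔤_ℝ = 𝔰𝔭(V, E)`, the dimensions `(10; 4, 6; 3)`, `B(Xⁿ) = D(Xⁿ)` for all `n` -/

section Consequences

variable {ι : Type*} [Fintype ι] [DecidableEq ι] {E : Type*} [NormedAddCommGroup E] [NormedSpace ℂ E]
  {Φ : (ι → ℝ) ≃L[ℝ] E} {η : E [⋀^Fin 2]→L[ℝ] ℝ}

/-- **`𝔥𝔤_ℝ = 𝔰𝔭(V, E)`** for an abelian surface with `End_ℚ(X) = ℚ` (as subsets of `M_ι(ℝ)`).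
[cite: MoonenZarhin1999LowDim, §2 (2.2)] [cite: Lange2023AbelianVarietiesComplex, §7.3.1, proof of Prop. 7.3.2] -/
theorem IsRiemannForm.coe_hodgeGroupLie_eq_skewAdjointMatricesSubmodule_of_finrank_eq_two_of_endAlgRat_eq_bot
    [FiniteDimensional ℂ E] (hη : IsRiemannForm Φ η) (h2 : finrank ℂ E = 2) (hE : endAlgRat Φ = ⊥) :
    (hodgeGroupLie Φ : Set (Matrix ι ι ℝ)) = skewAdjointMatricesSubmodule (latticeGram Φ η) :=
  hη.hodgeGroup_eq_spGroup_iff_coe_hodgeGroupLie_eq.1 (hη.hodgeGroup_eq_spGroup_of_finrank_eq_two_of_endAlgRat_eq_bot h2 hE)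

/-- **`dim_ℝ 𝔥𝔤_ℝ = 10 = dim Sp₄`** for an abelian surface with `End_ℚ(X) = ℚ` (`g(2g+1)` at `g = 2`; the sixth of the six
types `dim 𝔥𝔤_ℝ ∈ {1, 2, 3, 4, 6, 10}` of the tree's `ComplexTorusHodgeLieAlgebraAbelianSurfacesSixTypes`).
[cite: MoonenZarhin1999LowDim, §2 (2.2) ("`≅ Sp_{4,ℚ}`")] [cite: Lange2023AbelianVarietiesComplex, §7.3.1, proof of Prop. 7.3.2] -/
theorem IsRiemannForm.finrank_hodgeGroupLie_eq_ten_of_finrank_eq_two_of_endAlgRat_eq_bot [FiniteDimensional ℂ E]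
    (hη : IsRiemannForm Φ η) (h2 : finrank ℂ E = 2) (hE : endAlgRat Φ = ⊥) : finrank ℝ (hodgeGroupLie Φ) = 10 := by
  rw [hη.hodgeGroup_eq_spGroup_iff_finrank_hodgeGroupLie_eq.1
    (hη.hodgeGroup_eq_spGroup_of_finrank_eq_two_of_endAlgRat_eq_bot h2 hE), h2]

/-- **`dim_ℂ 𝔤 = dim_ℂ Lie Hg(X)(ℂ) = 10`** for an abelian surface with `End_ℚ(X) = ℚ`.
[cite: MoonenZarhin1999LowDim, §2 (2.2)] [cite: Lange2023AbelianVarietiesComplex, §7.3.1, proof of Prop. 7.3.3 ("`Hg(X)(ℂ) = Sp(V, E)(ℂ) ≃ Sp_{2g}(ℂ)`")] -/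
theorem IsRiemannForm.finrank_hodgeGroupComplexLie_eq_ten_of_finrank_eq_two_of_endAlgRat_eq_bot [FiniteDimensional ℂ E]
    (hη : IsRiemannForm Φ η) (h2 : finrank ℂ E = 2) (hE : endAlgRat Φ = ⊥) :
    finrank ℂ (hodgeGroupComplexLie Φ) = 10 := by
  rw [finrank_hodgeGroupComplexLie_eq_finrank_hodgeGroupLie,
    hη.finrank_hodgeGroupLie_eq_ten_of_finrank_eq_two_of_endAlgRat_eq_bot h2 hE]

/-- **`dim 𝔨 = 4 = dim 𝔲(2)`** for an abelian surface with `End_ℚ(X) = ℚ`. [cite: MoonenZarhin1999LowDim, §2 (2.2)]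
[cite: Lange2023AbelianVarietiesComplex, §7.1.2 Prop. 7.1.9 and §7.3.1 Prop. 7.3.2] -/
theorem IsRiemannForm.finrank_hodgeIsotropyLie_eq_four_of_finrank_eq_two_of_endAlgRat_eq_bot [FiniteDimensional ℂ E]
    (hη : IsRiemannForm Φ η) (h2 : finrank ℂ E = 2) (hE : endAlgRat Φ = ⊥) : finrank ℝ (hodgeIsotropyLie Φ) = 4 := by
  rw [hη.finrank_hodgeIsotropyLie_eq_sq_of_hodgeGroup_eq_spGroup
    (hη.hodgeGroup_eq_spGroup_of_finrank_eq_two_of_endAlgRat_eq_bot h2 hE), h2]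
  norm_num

/-- **`dim 𝔭 = 6 = dim_ℝ 𝔥₂`** for an abelian surface with `End_ℚ(X) = ℚ`: the Hodge orbit is open in the Siegel space,
infinitesimally. [cite: MoonenZarhin1999LowDim, §2 (2.2)] [cite: Lange2023AbelianVarietiesComplex, §7.1.2 Prop. 7.1.9 and §7.3.1 Prop. 7.3.2] -/
theorem IsRiemannForm.finrank_hodgeCartanP_eq_six_of_finrank_eq_two_of_endAlgRat_eq_bot [FiniteDimensional ℂ E]
    (hη : IsRiemannForm Φ η) (h2 : finrank ℂ E = 2) (hE : endAlgRat Φ = ⊥) : finrank ℝ (hodgeCartanP Φ) = 6 := by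
  rw [hη.finrank_hodgeCartanP_eq_of_hodgeGroup_eq_spGroup
    (hη.hodgeGroup_eq_spGroup_of_finrank_eq_two_of_endAlgRat_eq_bot h2 hE), h2]

/-- **`dim_ℂ 𝔤^{-1,1} = 3 = dim_ℂ 𝔥₂`**: the Mumford–Tate domain of an abelian surface with `End_ℚ(X) = ℚ` has the dimension
of the Siegel upper half space of degree `2`. [cite: MoonenZarhin1999LowDim, §2 (2.2)]
[cite: GreenGriffithsKerr2012, §II.A (p. 46)] [cite: Lange2023AbelianVarietiesComplex, §3.1.1 and §7.3.1 Prop. 7.3.2] -/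
theorem IsRiemannForm.finrank_hodgeLieType_one_eq_three_of_finrank_eq_two_of_endAlgRat_eq_bot [FiniteDimensional ℂ E]
    (hη : IsRiemannForm Φ η) (h2 : finrank ℂ E = 2) (hE : endAlgRat Φ = ⊥) : finrank ℂ (hodgeLieType Φ 1) = 3 := by
  rw [hη.finrank_hodgeLieType_one_eq_choose_two_of_hodgeGroup_eq_spGroup
    (hη.hodgeGroup_eq_spGroup_of_finrank_eq_two_of_endAlgRat_eq_bot h2 hE), h2]
  rfl

/-- **"`B(Xⁿ) = D(Xⁿ)` FOR ALL `n`": every power of an abelian surface with `End_ℚ(X) = ℚ` has its Hodge classes of every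
codimension spanned by products of divisor classes** ("In particular the Hodge conjecture is true for all such `Xⁿ`" —
through `Hg(X) = Sp(V, E)` and the tree's invariant theory `…_of_hodgeGroup_eq_spGroup`, Lange Prop. 7.3.3 / (1.8)).
[cite: MoonenZarhin1999LowDim, §2 p. 715 and (1.8)] [cite: Lange2023AbelianVarietiesComplex, §7.3.2 Prop. 7.3.3 and Thm. 7.3.4]
[cite: Gordon1997, Thm. 7.5] -/
theorem IsRiemannForm.forall_divisorClasses_eq_hodgeClasses_powPeriod_of_finrank_eq_two_of_endAlgRat_eq_bot
    [FiniteDimensional ℂ E] (hη : IsRiemannForm Φ η) (h2 : finrank ℂ E = 2) (hE : endAlgRat Φ = ⊥) :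
    ∀ k p : ℕ, divisorClasses (powPeriod Φ k) p = hodgeClasses (powPeriod Φ k) p :=
  hη.forall_divisorClasses_eq_hodgeClasses_powPeriod_of_hodgeGroup_eq_spGroup Φ
    (hη.hodgeGroup_eq_spGroup_of_finrank_eq_two_of_endAlgRat_eq_bot h2 hE)

/-- The `IsAbelianVariety` form of "`B(Xⁿ) = D(Xⁿ)` for all `n`" for abelian surfaces with `End_ℚ(X) = ℚ`.
[cite: MoonenZarhin1999LowDim, §2 p. 715 and (2.2)] [cite: Lange2023AbelianVarietiesComplex, §7.3.2 Prop. 7.3.3] -/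
theorem IsAbelianVariety.forall_divisorClasses_eq_hodgeClasses_powPeriod_of_finrank_eq_two_of_endAlgRat_eq_bot
    [FiniteDimensional ℂ E] (hX : IsAbelianVariety Φ) (h2 : finrank ℂ E = 2) (hE : endAlgRat Φ = ⊥) :
    ∀ k p : ℕ, divisorClasses (powPeriod Φ k) p = hodgeClasses (powPeriod Φ k) p := by
  obtain ⟨η, hη⟩ := hX
  exact hη.forall_divisorClasses_eq_hodgeClasses_powPeriod_of_finrank_eq_two_of_endAlgRat_eq_bot h2 hE

end Consequences

/-! ## §4 Moonen–Zarhin (2.3), Type I(1): an abelian THREEFOLD with `End_ℚ(X) = ℚ` is Hodge-general, `Hg(X) = Sp(V, E) ≅ Sp₆`,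
through the rank-six engine `SymplecticThetaSix.core_dichotomy` / `skeleton_radical` and the `ℚ`-form `𝒜 = hodgeGroupLieRat Φ` -/

section Threefold

variable {ι : Type*} [Fintype ι] [DecidableEq ι] {E : Type*} [NormedAddCommGroup E] [NormedSpace ℂ E]
  {Φ : (ι → ℝ) ≃L[ℝ] E} {η : E [⋀^Fin 2]→L[ℝ] ℝ}

omit [DecidableEq ι] in
/-- `(A B) ⊗ 1 = (A ⊗ 1)(B ⊗ 1)` over `ℂ`. [folklore] -/
private theorem map_ratCast_mul₄₇ (A B : Matrix ι ι ℚ) :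
    (A * B).map ((↑) : ℚ → ℂ) = A.map ((↑) : ℚ → ℂ) * B.map ((↑) : ℚ → ℂ) :=
  Matrix.map_mul (f := Rat.castHom ℂ)

omit [Fintype ι] [DecidableEq ι] in
/-- `(A - B) ⊗ 1 = A ⊗ 1 - B ⊗ 1` over `ℂ`. [folklore] -/
private theorem map_ratCast_sub₄₇ (A B : Matrix ι ι ℚ) :
    (A - B).map ((↑) : ℚ → ℂ) = A.map ((↑) : ℚ → ℂ) - B.map ((↑) : ℚ → ℂ) :=
  Matrix.map_sub _ (map_sub (Rat.castHom ℂ)) A B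

omit [Fintype ι] [DecidableEq ι] in
/-- `(Σ_s q_s u_s) ⊗ 1 = Σ_s q_s (u_s ⊗ 1)` over `ℂ`. [folklore] -/
private theorem map_ratCast_sum_smul₄₇ {m : ℕ} (q : Fin m → ℚ) (u : Fin m → Matrix ι ι ℚ) :
    (∑ s, q s • u s).map ((↑) : ℚ → ℂ) = ∑ s, (q s : ℂ) • (u s).map ((↑) : ℚ → ℂ) := by
  ext i j
  simp only [Matrix.map_apply, Matrix.sum_apply, Matrix.smul_apply, smul_eq_mul, Rat.cast_sum, Rat.cast_mul]

/-- `Matrix.toLin'` is multiplicative into `End(ℂ^ι)`. [folklore] -/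
private theorem toLin'_mul_toLin'₄₇ (M N : Matrix ι ι ℂ) :
    Matrix.toLin' M * Matrix.toLin' N = Matrix.toLin' (M * N) := by
  rw [Matrix.toLin'_mul]; rfl

/-- **Descent of radicals** (the determinant form of "a linear system with coefficients in a subfield which is solvable
over the big field is solvable over the subfield"): if a `ℂ`-bilinear form `ψ` has a RATIONAL Gram matrix `A` on a family
`e`, and a nonzero complex combination `Σ cᵢ eᵢ` is `ψ`-orthogonal to every `eⱼ`, then so is a nonzero RATIONAL
combination. [cite: HoffmanKunze1971LinearAlgebra, §1.4 (closing remark) and §5.4] -/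
private theorem exists_rat_radical₄₇ {m : ℕ} {W : Type*} [AddCommGroup W] [Module ℂ W] (e : Fin m → W)
    (ψ : W →ₗ[ℂ] W →ₗ[ℂ] ℂ) (A : Matrix (Fin m) (Fin m) ℚ) (hA : ∀ i j, ψ (e i) (e j) = (A i j : ℂ))
    {c : Fin m → ℂ} (hc0 : c ≠ 0) (hrad : ∀ j, ψ (∑ i, c i • e i) (e j) = 0) :
    ∃ d : Fin m → ℚ, d ≠ 0 ∧ ∀ j, ψ (∑ i, (d i : ℂ) • e i) (e j) = 0 := by
  classical
  have hcA : c ᵥ* A.map ((↑) : ℚ → ℂ) = 0 := by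
    ext j
    have h := hrad j
    rw [map_sum, LinearMap.sum_apply] at h
    simp only [map_smul, LinearMap.smul_apply, smul_eq_mul, hA] at h
    simpa only [Matrix.vecMul, dotProduct, Matrix.map_apply, Pi.zero_apply] using h
  have hdetC : (A.map ((↑) : ℚ → ℂ)).det = 0 := Matrix.exists_vecMul_eq_zero_iff.1 ⟨c, hc0, hcA⟩
  have hdetQ : A.det = 0 := by
    have h : (Rat.castHom ℂ) A.det = 0 := by rw [RingHom.map_det, RingHom.mapMatrix_apply, Rat.coe_castHom, hdetC]
    exact (Rat.castHom ℂ).injective (by rw [h, map_zero])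
  obtain ⟨d, hd0, hdA⟩ := Matrix.exists_vecMul_eq_zero_iff.2 hdetQ
  refine ⟨d, hd0, fun j ↦ ?_⟩
  rw [map_sum, LinearMap.sum_apply]
  simp only [map_smul, LinearMap.smul_apply, smul_eq_mul, hA]
  have h := congrArg (fun q : ℚ ↦ (q : ℂ)) (congrFun hdA j)
  simpa only [Matrix.vecMul, dotProduct, Pi.zero_apply, Rat.cast_sum, Rat.cast_mul, Rat.cast_zero] using h

/-- **THE LIE STEP OF MOONEN–ZARHIN (2.3), TYPE I(1): `𝔰𝔭(V_ℂ, E_ℂ) ⊆ 𝔤 = Lie Hg(X)(ℂ)`** for a polarised complex torus of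
dimension `3` with `End_ℚ(X) = ℚ`.  Proof: `V_ℂ` is `𝔤`-irreducible (§1) and `V^{-1,0}`, `V^{0,-1}` are `3`-spaces; the
rank-six dichotomy `SymplecticThetaSix.core_dichotomy` for `T = -i(J ⊗ 1)` either puts `𝔲⁺ ⊕ 𝔤𝔩(V^{-1,0}) ⊕ 𝔲⁻ ⊆ 𝔤` (and a
skew `Z` is `Z₋ + Z₀ + Z₊` along `ad T`), or yields the E³-type skeleton of (2.5), on which `SymplecticThetaSix.skeleton_radical`
gives a nonzero radical vector of the invariant form `Ψ(X, Z) = tr_{V_ℂ}(XZ) - 2 tr_𝔤(ad X ad Z)` with `Rad Ψ ⊆ 𝔷(T)`.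
But `Ψ` is RATIONAL on the `ℚ`-form `𝒜 = hodgeGroupLieRat Φ` of `𝔤` (GGK: "`𝒜_ℂ = 𝒜 ⊗ ℂ`"; traces and structure constants in
a `ℚ`-basis of `𝒜`), so `Rad Ψ` contains a nonzero RATIONAL `X ∈ 𝒜` (descent of `det = 0`); `X` commutes with `T`, i.e. with
`J`, so `X ∈ End_ℚ(X) = ℚ` is a scalar of trace `0`, `X = 0` — contradiction. [cite: MoonenZarhin1999LowDim, §2 (2.3) ("Type I(1): `X` is an abelian 3-fold with `End⁰(X) = ℚ`. Then `Hg(X) = Sp(V,φ) ≅ Sp_{6,ℚ}`") and (2.5)]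
[cite: GreenGriffithsKerr2012, §II.C, Lemma after (II.C.1) ("`𝒜_ℂ = 𝒜 ⊗ ℂ`")] [cite: HoffmanKunze1971LinearAlgebra, §1.4 (closing remark)] -/
theorem IsRiemannForm.mem_hodgeGroupLieC_of_transpose_mul_add_eq_zero_of_finrank_eq_three [FiniteDimensional ℂ E]
    (hη : IsRiemannForm Φ η) (h3 : finrank ℂ E = 3) (hE : endAlgRat Φ = ⊥) {Z : Matrix ι ι ℂ}
    (hZ : Zᵀ * (latticeGram Φ η).map Complex.ofRealHom + (latticeGram Φ η).map Complex.ofRealHom * Z = 0) :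
    Z ∈ hodgeGroupLieC Φ := by
  classical
  letI : LieRing (Matrix ι ι ℂ) := LieRing.ofAssociativeRing
  letI : LieRing (Matrix ι ι ℚ) := LieRing.ofAssociativeRing
  -- the form `ω = E_ℂ` on `M = ℂ^ι`
  have hJJ := jMatrix_mul_jMatrix Φ
  have hGT : ((latticeGram Φ η).map Complex.ofRealHom)ᵀ = -(latticeGram Φ η).map Complex.ofRealHom := by
    rw [← Matrix.transpose_map, latticeGram_transpose, Matrix.map_neg _ (map_neg Complex.ofRealHom)]
  set ω : LinearMap.BilinForm ℂ (ι → ℂ) := Matrix.toBilin' ((latticeGram Φ η).map Complex.ofRealHom) with hωdef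
  have hω : ∀ x y, ω x y = x ⬝ᵥ ((latticeGram Φ η).map Complex.ofRealHom *ᵥ y) := fun x y ↦
    Matrix.toBilin'_apply' _ x y
  have hωnd : ω.Nondegenerate := by
    refine LinearMap.BilinForm.nondegenerate_toBilin'_iff_det_ne_zero.2 ?_
    rw [← RingHom.mapMatrix_apply, ← RingHom.map_det]
    exact Complex.ofReal_ne_zero.2 hη.isUnit_det_latticeGram.ne_zero
  have hωalt : ∀ x y, ω x y = -ω y x := fun x y ↦ by
    rw [hω, hω]; exact dotProduct_mulVec_eq_neg_of_transpose_eq_neg hGT x y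
  -- `𝔊 = 𝔤`, transported to `End(ℂ^ι)` along `Matrix.toLin'`
  set 𝔊 : Submodule ℂ (Module.End ℂ (ι → ℂ)) :=
    (hodgeGroupComplexLie Φ).toSubmodule.comap
      (LinearMap.toMatrix' : Module.End ℂ (ι → ℂ) ≃ₗ[ℂ] Matrix ι ι ℂ).toLinearMap with h𝔊def
  have hmem𝔊 : ∀ Y : Module.End ℂ (ι → ℂ), Y ∈ 𝔊 ↔ LinearMap.toMatrix' Y ∈ hodgeGroupLieC Φ := fun Y ↦ by
    rw [h𝔊def, Submodule.mem_comap, LinearEquiv.coe_coe, LieSubalgebra.mem_toSubmodule,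
      mem_hodgeGroupComplexLie_iff_mem_hodgeGroupLieC]
  have htoLin : ∀ M : Matrix ι ι ℂ, Matrix.toLin' M ∈ 𝔊 ↔ M ∈ hodgeGroupLieC Φ := fun M ↦ by
    rw [hmem𝔊, LinearMap.toMatrix'_toLin']
  have hYv : ∀ (Y : Module.End ℂ (ι → ℂ)) (v : ι → ℂ), Y v = LinearMap.toMatrix' Y *ᵥ v := fun Y v ↦ by
    conv_lhs => rw [← Matrix.toLin'_toMatrix' Y]
    rw [Matrix.toLin'_apply]
  have hbr : ∀ Y ∈ 𝔊, ∀ Y' ∈ 𝔊, Y * Y' - Y' * Y ∈ 𝔊 := fun Y hY Y' hY' ↦ by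
    rw [hmem𝔊] at hY hY' ⊢
    rw [map_sub, LinearMap.toMatrix'_mul, LinearMap.toMatrix'_mul, ← Ring.lie_def]
    exact (hodgeGroupLieC Φ).lie_mem hY hY'
  have had : ∀ Y ∈ 𝔊, ∀ Y' ∈ 𝔊, (LinearMap.mulLeft ℂ Y - LinearMap.mulRight ℂ Y) Y' ∈ 𝔊 := fun Y hY Y' hY' ↦ by
    simpa using hbr Y hY Y' hY'
  have hskew : ∀ Y ∈ 𝔊, ∀ x y, ω (Y x) y + ω x (Y y) = 0 := fun Y hY x y ↦ by
    rw [hω, hω, hYv, hYv]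
    exact dotProduct_mulVec_add_eq_zero_of_transpose_mul_add_eq_zero
      (hη.transpose_mul_map_latticeGram_add_eq_zero_of_mem_hodgeGroupLieC ((hmem𝔊 Y).1 hY)) x y
  -- the involution `T = -i(J ⊗ 1) ∈ 𝔊`
  set T : Module.End ℂ (ι → ℂ) := Matrix.toLin' ((-Complex.I) • (jMatrix Φ).map Complex.ofRealHom) with hTdef
  have hTv : ∀ v, T v = -(Complex.I • ((jMatrix Φ).map Complex.ofRealHom *ᵥ v)) := fun v ↦ by
    rw [hTdef, Matrix.toLin'_apply, Matrix.smul_mulVec, neg_smul]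
  have hT𝔊 : T ∈ 𝔊 := by
    rw [hmem𝔊, hTdef, LinearMap.toMatrix'_toLin']
    exact ComplexTorus.smul_mem_hodgeGroupLieC Φ (jMatrix_map_mem_hodgeGroupLieC Φ) _
  have hJJv : ∀ v : ι → ℂ, (jMatrix Φ).map Complex.ofRealHom *ᵥ ((jMatrix Φ).map Complex.ofRealHom *ᵥ v) = -v :=
    map_ofRealHom_mulVec_mulVec_of_mul_self hJJ
  have hTT : ∀ v, T (T v) = v := fun v ↦ by
    rw [hTv, hTv, Matrix.mulVec_neg, Matrix.mulVec_smul, hJJv]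
    simp only [smul_neg, neg_neg, smul_smul, Complex.I_mul_I, neg_smul, one_smul]
  have hP : ∀ x ∈ hodgeFiltrationConj (jMatrix Φ), T x = x := fun x hx ↦ by
    rw [hTv, mem_hodgeFiltrationConj_iff.1 hx, smul_smul, Complex.I_mul_I, neg_smul, one_smul, neg_neg]
  have hQ : ∀ x ∈ hodgeFiltration (jMatrix Φ), T x = -x := fun x hx ↦ by
    rw [hTv, mem_hodgeFiltration_iff.1 hx, smul_neg, smul_smul, Complex.I_mul_I, neg_smul, one_smul, neg_neg]
  have hPmem : ∀ v, (2 : ℂ)⁻¹ • (v + T v) ∈ hodgeFiltrationConj (jMatrix Φ) := fun v ↦ by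
    rw [hTv, ← sub_eq_add_neg]
    exact Submodule.smul_mem _ _ (sub_I_smul_mulVec_mem_hodgeFiltrationConj hJJ v)
  have hQmem : ∀ v, (2 : ℂ)⁻¹ • (v - T v) ∈ hodgeFiltration (jMatrix Φ) := fun v ↦ by
    rw [hTv, sub_neg_eq_add]
    exact Submodule.smul_mem _ _ (add_I_smul_mulVec_mem_hodgeFiltration hJJ v)
  -- `g = 3`: the pieces are `3`-spaces, `|ι| = 6`
  have hcard : Fintype.card ι = 6 := by rw [card_eq_two_mul_finrank Φ, h3]
  have hQ3 : finrank ℂ (hodgeFiltration (jMatrix Φ)) = 3 := by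
    have h := two_mul_finrank_hodgeFiltration hJJ
    omega
  have hP3 : finrank ℂ (hodgeFiltrationConj (jMatrix Φ)) = 3 := by rw [finrank_hodgeFiltrationConj_eq, hQ3]
  -- irreducibility (§1)
  have hirr : ∀ U : Submodule ℂ (ι → ℂ), (∀ Y ∈ 𝔊, ∀ u ∈ U, Y u ∈ U) → U = ⊥ ∨ U = ⊤ := fun U hU ↦
    hη.eq_bot_or_eq_top_of_forall_mulVec_mem hE fun M hM u hu ↦ by
      have h := hU (Matrix.toLin' M) ((htoLin M).2 hM) u hu
      rwa [Matrix.toLin'_apply] at h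
  -- the dichotomy
  rcases HodgeStructure.SymplecticThetaSix.core_dichotomy ω hωnd hωalt 𝔊 hbr hskew hT𝔊 hTT
      (P := hodgeFiltrationConj (jMatrix Φ)) (Q := hodgeFiltration (jMatrix Φ)) hP hQ hPmem hQmem hirr hP3 with
    ⟨hA, hB, hC⟩ | hbad
  · -- GOOD: `𝔲⁺ ⊕ 𝔤𝔩(V^{-1,0}) ⊕ 𝔲⁻ ⊆ 𝔤`; decompose `Z` along `ad T` inside the skew operators
    let 𝔰 : Submodule ℂ (Module.End ℂ (ι → ℂ)) :=
      { carrier := {Y | ∀ x y, ω (Y x) y + ω x (Y y) = 0}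
        zero_mem' := fun x y ↦ by simp
        add_mem' := by
          intro Y Y' hY hY' x y
          simp only [LinearMap.add_apply, map_add]
          have h1 := hY x y
          have h2 := hY' x y
          linear_combination h1 + h2
        smul_mem' := by
          intro c Y hY x y
          simp only [LinearMap.smul_apply, map_smul, smul_eq_mul]
          have h1 := hY x y
          linear_combination c * h1 }
    have hmem𝔰 : ∀ Y, Y ∈ 𝔰 ↔ ∀ x y, ω (Y x) y + ω x (Y y) = 0 := fun Y ↦ Iff.rfl
    have h𝔰br : ∀ Y ∈ 𝔰, ∀ Y' ∈ 𝔰, Y * Y' - Y' * Y ∈ 𝔰 := fun Y hY Y' hY' ↦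
      (hmem𝔰 _).2 (skew_commutator₄₇ ω ((hmem𝔰 Y).1 hY) ((hmem𝔰 Y').1 hY'))
    have hT𝔰 : T ∈ 𝔰 := (hmem𝔰 T).2 (hskew T hT𝔊)
    have hZ𝔰 : Matrix.toLin' Z ∈ 𝔰 := (hmem𝔰 _).2 fun x y ↦ by
      rw [hω, hω, Matrix.toLin'_apply, Matrix.toLin'_apply]
      exact dotProduct_mulVec_add_eq_zero_of_transpose_mul_add_eq_zero hZ x y
    obtain ⟨Ym, hYm, Y0, hY0, Yp, hYp, hYeq, hYpP, hYpim, hYmQ, hYmim, -, -, hY0P, hY0Q⟩ :=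
      HodgeStructure.SymplecticTheta.exists_decomp 𝔰 h𝔰br hT𝔰 hTT (P := hodgeFiltrationConj (jMatrix Φ))
        (Q := hodgeFiltration (jMatrix Φ)) hP hQ hPmem hQmem hZ𝔰
    have hmem : Matrix.toLin' Z ∈ 𝔊 := by
      rw [hYeq]
      refine 𝔊.add_mem (𝔊.add_mem ?_ ?_) ?_
      · exact hC Ym ((hmem𝔰 Ym).1 hYm) hYmQ hYmim
      · exact hB Y0 ((hmem𝔰 Y0).1 hY0) hY0P hY0Q
      · exact hA Yp ((hmem𝔰 Yp).1 hYp) hYpP hYpim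
    exact (htoLin Z).1 hmem
  · -- SKELETON: impossible, by the rational invariant `tr - 2κ` on the `ℚ`-form `𝒜` of `𝔤`
    exfalso
    obtain ⟨B₀, hB₀𝔊, C₁, hC₁𝔊, hB₀P, hB₀im, hC₁Q, hC₁im, hBC, hCB, hlineS, hlineC⟩ := hbad
    obtain ⟨S, hS𝔊, hS0, -, hSrad, hrad⟩ := HodgeStructure.SymplecticThetaSix.skeleton_radical ω hωnd hωalt 𝔊 hbr
      had hskew hT𝔊 hTT (P := hodgeFiltrationConj (jMatrix Φ)) (Q := hodgeFiltration (jMatrix Φ)) hP hQ hPmem hQmem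
      hirr hP3 hB₀𝔊 hB₀P hB₀im hC₁𝔊 hC₁Q hC₁im hBC hCB hlineS hlineC
    -- the invariant form `Ψ = tr_{V_ℂ}(XZ) - 2 tr_𝔊(ad X ad Z)` on `𝔊`
    let ad : ↥𝔊 → (↥𝔊 →ₗ[ℂ] ↥𝔊) := fun X ↦
      (LinearMap.mulLeft ℂ (X : Module.End ℂ (ι → ℂ)) - LinearMap.mulRight ℂ (X : Module.End ℂ (ι → ℂ))).restrict
        (had X.1 X.2)
    have had_coe : ∀ X W : ↥𝔊, ((ad X W : ↥𝔊) : Module.End ℂ (ι → ℂ)) = X * W - W * X := fun X W ↦ rfl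
    have had_add : ∀ X X' : ↥𝔊, ad (X + X') = ad X + ad X' := by
      intro X X'
      apply LinearMap.ext
      intro W
      apply Subtype.ext
      rw [LinearMap.add_apply, Submodule.coe_add, had_coe, had_coe, had_coe, Submodule.coe_add]
      noncomm_ring
    have had_smul : ∀ (c : ℂ) (X : ↥𝔊), ad (c • X) = c • ad X := by
      intro c X
      apply LinearMap.ext
      intro W
      apply Subtype.ext
      rw [LinearMap.smul_apply, Submodule.coe_smul, had_coe, had_coe, Submodule.coe_smul, smul_sub, smul_mul_assoc,
        mul_smul_comm]
    let Ψ : ↥𝔊 →ₗ[ℂ] ↥𝔊 →ₗ[ℂ] ℂ := LinearMap.mk₂ ℂ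
      (fun X W ↦ LinearMap.trace ℂ (ι → ℂ) ((X : Module.End ℂ (ι → ℂ)) * W) - 2 * LinearMap.trace ℂ ↥𝔊 (ad X ∘ₗ ad W))
      (by
        intro X X' W
        simp only [Submodule.coe_add, add_mul, map_add, had_add, LinearMap.add_comp]
        ring)
      (by
        intro c X W
        simp only [Submodule.coe_smul, smul_mul_assoc, map_smul, had_smul, LinearMap.smul_comp, smul_eq_mul]
        ring)
      (by
        intro X W W'
        simp only [Submodule.coe_add, mul_add, map_add, had_add, LinearMap.comp_add]
        ring)
      (by
        intro c X W
        simp only [Submodule.coe_smul, mul_smul_comm, map_smul, had_smul, LinearMap.comp_smul, smul_eq_mul]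
        ring)
    have hΨ : ∀ X W : ↥𝔊, Ψ X W = LinearMap.trace ℂ (ι → ℂ) ((X : Module.End ℂ (ι → ℂ)) * W) -
        2 * LinearMap.trace ℂ ↥𝔊 (ad X ∘ₗ ad W) := fun X W ↦ rfl
    -- the `ℚ`-form `𝒜 = hodgeGroupLieRat Φ` of `𝔤` and a `ℚ`-basis of it
    set 𝒜 : Submodule ℚ (Matrix ι ι ℚ) := (hodgeGroupLieRat Φ).toSubmodule with h𝒜def
    have hmem𝒜 : ∀ A : Matrix ι ι ℚ, A ∈ 𝒜 ↔ A ∈ hodgeGroupLieRat Φ := fun A ↦ by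
      rw [h𝒜def, LieSubalgebra.mem_toSubmodule]
    set n := finrank ℚ ↥𝒜 with hndef
    let b : Module.Basis (Fin n) ℚ ↥𝒜 := Module.finBasis ℚ ↥𝒜
    have hbC : ∀ i, ((b i : ↥𝒜) : Matrix ι ι ℚ).map ((↑) : ℚ → ℂ) ∈ hodgeGroupLieC Φ := fun i ↦
      map_ratCast_mem_hodgeGroupLieC_of_mem ((hmem𝒜 _).1 (b i).2)
    let Eb : Fin n → ↥𝔊 := fun i ↦
      ⟨Matrix.toLin' (((b i : ↥𝒜) : Matrix ι ι ℚ).map ((↑) : ℚ → ℂ)), (htoLin _).2 (hbC i)⟩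
    have hEb : ∀ i, ((Eb i : ↥𝔊) : Module.End ℂ (ι → ℂ)) = Matrix.toLin' (((b i : ↥𝒜) : Matrix ι ι ℚ).map ((↑) : ℚ → ℂ)) :=
      fun i ↦ rfl
    -- complexification of a rational element in the coordinates of `b`
    have hcoe : ∀ W : ↥𝒜, ((W : ↥𝒜) : Matrix ι ι ℚ).map ((↑) : ℚ → ℂ) =
        ∑ i, ((b.repr W i : ℚ) : ℂ) • ((b i : ↥𝒜) : Matrix ι ι ℚ).map ((↑) : ℚ → ℂ) := by
      intro W
      have hW : (W : Matrix ι ι ℚ) = ((∑ i, b.repr W i • b i : ↥𝒜) : Matrix ι ι ℚ) := by rw [b.sum_repr W]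
      rw [hW, Submodule.coe_sum]
      simp only [Submodule.coe_smul]
      exact map_ratCast_sum_smul₄₇ _ _
    have hcoeE : ∀ (W : ↥𝒜) (hW : Matrix.toLin' (((W : ↥𝒜) : Matrix ι ι ℚ).map ((↑) : ℚ → ℂ)) ∈ 𝔊),
        (⟨Matrix.toLin' (((W : ↥𝒜) : Matrix ι ι ℚ).map ((↑) : ℚ → ℂ)), hW⟩ : ↥𝔊) =
          ∑ i, ((b.repr W i : ℚ) : ℂ) • Eb i := by
      intro W hW
      apply Subtype.ext
      rw [Submodule.coe_sum]
      simp only [Submodule.coe_smul, hEb]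
      rw [hcoe W, map_sum]
      simp only [map_smul]
    -- the `Eb i` span `𝔊` ("`𝒜_ℂ = 𝒜 ⊗ ℂ`")
    have hspanE : ∀ W : ↥𝔊, ∃ c : Fin n → ℂ, W = ∑ i, c i • Eb i := by
      intro W
      have hW : LinearMap.toMatrix' (W : Module.End ℂ (ι → ℂ)) ∈
          Submodule.span ℂ (Set.range fun i ↦ ((b i : ↥𝒜) : Matrix ι ι ℚ).map ((↑) : ℚ → ℂ)) := by
        have h1 := (mem_hodgeGroupLieC_iff_mem_span_hodgeGroupLieRat Φ).1 ((hmem𝔊 _).1 W.2)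
        refine (Submodule.span_le.2 ?_) h1
        rintro _ ⟨A, hA, rfl⟩
        have h2 := hcoe ⟨A, (hmem𝒜 A).2 hA⟩
        rw [Submodule.coe_mk] at h2
        dsimp only
        rw [SetLike.mem_coe, h2]
        exact Submodule.sum_mem _ fun i _ ↦ Submodule.smul_mem _ _ (Submodule.subset_span ⟨i, rfl⟩)
      obtain ⟨c, hc⟩ := (Submodule.mem_span_range_iff_exists_fun ℂ).1 hW
      refine ⟨c, Subtype.ext ?_⟩
      rw [Submodule.coe_sum]
      simp only [Submodule.coe_smul, hEb]
      rw [← Matrix.toLin'_toMatrix' (W : Module.End ℂ (ι → ℂ)), ← hc, map_sum]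
      simp only [map_smul]
    -- and are independent (flatness of `ℂ/ℚ`)
    have hli : LinearIndependent ℂ Eb := by
      have h1 : LinearIndependent ℚ fun i ↦ ((b i : ↥𝒜) : Matrix ι ι ℚ) :=
        b.linearIndependent.map' 𝒜.subtype 𝒜.ker_subtype
      have h2 : LinearIndependent ℂ fun i ↦ (((b i : ↥𝒜) : Matrix ι ι ℚ)).map ((↑) : ℚ → ℂ) :=
        linearIndependent_map_ratCast ℂ h1
      have h3 : LinearIndependent ℂ fun i ↦ Matrix.toLin' ((((b i : ↥𝒜) : Matrix ι ι ℚ)).map ((↑) : ℚ → ℂ)) :=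
        h2.map' (Matrix.toLin' : Matrix ι ι ℂ ≃ₗ[ℂ] Module.End ℂ (ι → ℂ)).toLinearMap
          (LinearMap.ker_eq_bot.2 Matrix.toLin'.injective)
      exact LinearIndependent.of_comp 𝔊.subtype h3
    have hsp : ⊤ ≤ Submodule.span ℂ (Set.range Eb) := by
      rintro W -
      obtain ⟨c, rfl⟩ := hspanE W
      exact Submodule.sum_mem _ fun i _ ↦ Submodule.smul_mem _ _ (Submodule.subset_span ⟨i, rfl⟩)
    let bE : Module.Basis (Fin n) ℂ ↥𝔊 := Module.Basis.mk hli hsp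
    have hbE : ∀ i, bE i = Eb i := fun i ↦ Module.Basis.mk_apply hli hsp i
    -- `Ψ` is RATIONAL on `𝒜 × 𝒜`: the trace part
    have htr : ∀ s t, LinearMap.trace ℂ (ι → ℂ) ((Eb s : Module.End ℂ (ι → ℂ)) * Eb t) =
        ((((b s : ↥𝒜) : Matrix ι ι ℚ) * ((b t : ↥𝒜) : Matrix ι ι ℚ)).trace : ℚ) := by
      intro s t
      rw [hEb, hEb, toLin'_mul_toLin'₄₇, ← map_ratCast_mul₄₇, Matrix.trace_toLin'_eq]
      simp only [Matrix.trace, Matrix.diag_apply, Matrix.map_apply, Rat.cast_sum]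
    -- … and the Killing part (structure constants in the `ℚ`-basis)
    have hkill : ∀ s t, ∃ q : ℚ, LinearMap.trace ℂ ↥𝔊 (ad (Eb s) ∘ₗ ad (Eb t)) = (q : ℂ) := by
      intro s t
      set f := ad (Eb s) ∘ₗ ad (Eb t) with hf
      have hWmem : ∀ i, ((b s : ↥𝒜) : Matrix ι ι ℚ) * (((b t : ↥𝒜) : Matrix ι ι ℚ) * ((b i : ↥𝒜) : Matrix ι ι ℚ) -
          ((b i : ↥𝒜) : Matrix ι ι ℚ) * ((b t : ↥𝒜) : Matrix ι ι ℚ)) -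
          (((b t : ↥𝒜) : Matrix ι ι ℚ) * ((b i : ↥𝒜) : Matrix ι ι ℚ) - ((b i : ↥𝒜) : Matrix ι ι ℚ) * ((b t : ↥𝒜) : Matrix ι ι ℚ)) *
            ((b s : ↥𝒜) : Matrix ι ι ℚ) ∈ 𝒜 := by
        intro i
        rw [hmem𝒜, ← Ring.lie_def, ← Ring.lie_def]
        exact (hodgeGroupLieRat Φ).lie_mem ((hmem𝒜 _).1 (b s).2)
          ((hodgeGroupLieRat Φ).lie_mem ((hmem𝒜 _).1 (b t).2) ((hmem𝒜 _).1 (b i).2))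
      have hfE : ∀ i, f (Eb i) = ⟨Matrix.toLin' ((((⟨_, hWmem i⟩ : ↥𝒜) : ↥𝒜) : Matrix ι ι ℚ).map ((↑) : ℚ → ℂ)),
          (htoLin _).2 (map_ratCast_mem_hodgeGroupLieC_of_mem ((hmem𝒜 _).1 (hWmem i)))⟩ := by
        intro i
        apply Subtype.ext
        rw [hf, LinearMap.comp_apply, had_coe, had_coe]
        simp only [hEb, map_ratCast_sub₄₇, map_ratCast_mul₄₇, map_sub, ← toLin'_mul_toLin'₄₇]
      have hfE' : ∀ i, f (bE i) = ∑ l, ((b.repr ⟨_, hWmem i⟩ l : ℚ) : ℂ) • bE l := by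
        intro i
        rw [hbE, hfE, hcoeE]
        exact Finset.sum_congr rfl fun l _ ↦ by rw [hbE]
      refine ⟨∑ i, b.repr ⟨_, hWmem i⟩ i, ?_⟩
      rw [LinearMap.trace_eq_matrix_trace ℂ bE f, Matrix.trace]
      push_cast
      refine Finset.sum_congr rfl fun i _ ↦ ?_
      rw [Matrix.diag_apply, LinearMap.toMatrix_apply, hfE', bE.repr_sum_self]
    have hrat : ∀ s t, ∃ q : ℚ, Ψ (Eb s) (Eb t) = (q : ℂ) := by
      intro s t
      obtain ⟨q, hq⟩ := hkill s t
      refine ⟨(((b s : ↥𝒜) : Matrix ι ι ℚ) * ((b t : ↥𝒜) : Matrix ι ι ℚ)).trace - 2 * q, ?_⟩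
      rw [hΨ, htr, hq]
      push_cast
      ring
    choose A hA using hrat
    -- `S = Σ cᵢ Ebᵢ ≠ 0` is `Ψ`-orthogonal to every `Eb j`; descend to a rational radical vector
    obtain ⟨c, hc⟩ := hspanE ⟨S, hS𝔊⟩
    have hc0 : c ≠ 0 := by
      rintro rfl
      apply hS0
      have h := congrArg Subtype.val hc
      simpa using h
    have hSradE : ∀ j, Ψ (∑ i, c i • Eb i) (Eb j) = 0 := fun j ↦ by
      rw [← hc, hΨ]
      exact sub_eq_zero.2 (hSrad _ (Eb j).2)
    obtain ⟨d, hd0, hdrad⟩ := exists_rat_radical₄₇ Eb Ψ (Matrix.of fun s t ↦ A s t) (fun s t ↦ by rw [Matrix.of_apply]; exact hA s t)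
      hc0 hSradE
    -- the rational radical vector `X = Σ dᵢ bᵢ ∈ 𝒜`
    set Xa : ↥𝒜 := ∑ i, d i • b i with hXa
    have hXa0 : Xa ≠ 0 := by
      intro h
      apply hd0
      have hlin := b.linearIndependent
      rw [Fintype.linearIndependent_iff] at hlin
      funext i
      exact hlin d h i
    have hreprXa : ∀ i, b.repr Xa i = d i := fun i ↦ by rw [hXa, b.repr_sum_self]
    have hXmem : Matrix.toLin' (((Xa : ↥𝒜) : Matrix ι ι ℚ).map ((↑) : ℚ → ℂ)) ∈ 𝔊 :=
      (htoLin _).2 (map_ratCast_mem_hodgeGroupLieC_of_mem ((hmem𝒜 _).1 Xa.2))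
    have hXE : (⟨Matrix.toLin' (((Xa : ↥𝒜) : Matrix ι ι ℚ).map ((↑) : ℚ → ℂ)), hXmem⟩ : ↥𝔊) = ∑ i, (d i : ℂ) • Eb i := by
      rw [hcoeE Xa hXmem]
      exact Finset.sum_congr rfl fun i _ ↦ by rw [hreprXa]
    have hXrad : ∀ W : ↥𝔊, Ψ ⟨Matrix.toLin' (((Xa : ↥𝒜) : Matrix ι ι ℚ).map ((↑) : ℚ → ℂ)), hXmem⟩ W = 0 := by
      intro W
      obtain ⟨w, rfl⟩ := hspanE W
      rw [hXE, map_sum]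
      exact Finset.sum_eq_zero fun j _ ↦ by rw [map_smul, hdrad j, smul_zero]
    -- hence `X ⊗ 1` commutes with `T`, so `X` commutes with `J`: `X ∈ End_ℚ(X) = ℚ`
    have hXT : Matrix.toLin' (((Xa : ↥𝒜) : Matrix ι ι ℚ).map ((↑) : ℚ → ℂ)) * T =
        T * Matrix.toLin' (((Xa : ↥𝒜) : Matrix ι ι ℚ).map ((↑) : ℚ → ℂ)) := by
      refine hrad _ hXmem fun W hW ↦ ?_
      have h := hXrad ⟨W, hW⟩
      rw [hΨ] at h
      exact sub_eq_zero.1 h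
    have hXJ : ((Xa : ↥𝒜) : Matrix ι ι ℚ).map ((↑) : ℚ → ℝ) * jMatrix Φ = jMatrix Φ * ((Xa : ↥𝒜) : Matrix ι ι ℚ).map ((↑) : ℚ → ℝ) := by
      rw [hTdef, toLin'_mul_toLin'₄₇, toLin'_mul_toLin'₄₇] at hXT
      have h1 := Matrix.toLin'.injective hXT
      rw [Matrix.mul_smul, Matrix.smul_mul] at h1
      have h2 := smul_right_injective (Matrix ι ι ℂ) (neg_ne_zero.2 Complex.I_ne_zero) h1
      rw [← map_ratCast_map_ofRealHom₄₇, ← Matrix.map_mul, ← Matrix.map_mul] at h2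
      exact Matrix.map_injective Complex.ofReal_injective h2
    have hXend : ((Xa : ↥𝒜) : Matrix ι ι ℚ) ∈ endAlgRat Φ := (mem_endAlgRat_iff Φ _).2 hXJ
    rw [hE, Algebra.mem_bot] at hXend
    obtain ⟨q, hq⟩ := hXend
    -- a scalar of trace zero vanishes
    have htr0 := trace_eq_zero_of_mem_hodgeGroupLieRat ((hmem𝒜 _).1 Xa.2)
    rw [← hq, Algebra.algebraMap_eq_smul_one, Matrix.trace_smul, Matrix.trace_one, hcard, smul_eq_mul] at htr0
    have hq0 : q = 0 := by
      have h : (q : ℚ) * 6 = 0 := by exact_mod_cast htr0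
      simpa using h
    apply hXa0
    apply Subtype.ext
    rw [← hq, hq0, map_zero]
    rfl

/-- **MOONEN–ZARHIN (2.3), TYPE I(1): an abelian threefold with `End_ℚ(X) = ℚ` is Hodge-general, `Hg(X) = Sp(V, E) ≅ Sp₆`** —
for every polarised complex torus `(X, E)` of dimension `3` with `End_ℚ(X) = ℚ` ("Type I(1): `X` is an abelian 3-fold with
`End⁰(X) = ℚ`. Then `Hg(X) = Sp(V,φ) ≅ Sp_{6,ℚ}`"). [cite: MoonenZarhin1999LowDim, §2 (2.3)]
[cite: Lange2023AbelianVarietiesComplex, §7.3.1, proof of Prop. 7.3.2 (pp. 337–338)] -/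
theorem IsRiemannForm.hodgeGroup_eq_spGroup_of_finrank_eq_three_of_endAlgRat_eq_bot [FiniteDimensional ℂ E]
    (hη : IsRiemannForm Φ η) (h3 : finrank ℂ E = 3) (hE : endAlgRat Φ = ⊥) : hodgeGroup Φ = spGroup Φ η :=
  hη.hodgeGroup_eq_spGroup_iff_forall_mem_hodgeGroupLie.2 fun _ hX ↦ (mem_hodgeGroupLie_iff_map_mem Φ).2
    (hη.mem_hodgeGroupLieC_of_transpose_mul_add_eq_zero_of_finrank_eq_three h3 hE (transpose_map_mul_add_eq_zero hX))

/-- **For abelian threefolds, `Hg(X) = Sp(V, E) ⟺ End_ℚ(X) = ℚ`.** [cite: MoonenZarhin1999LowDim, §2 (2.3)]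
[cite: Lange2023AbelianVarietiesComplex, §7.2.2 Prop. 7.2.5 and §7.3.1 Prop. 7.3.2–7.3.3] -/
theorem IsRiemannForm.hodgeGroup_eq_spGroup_iff_endAlgRat_eq_bot_of_finrank_eq_three [FiniteDimensional ℂ E]
    (hη : IsRiemannForm Φ η) (h3 : finrank ℂ E = 3) : hodgeGroup Φ = spGroup Φ η ↔ endAlgRat Φ = ⊥ :=
  ⟨hη.endAlgRat_eq_bot_of_hodgeGroup_eq_spGroup, hη.hodgeGroup_eq_spGroup_of_finrank_eq_three_of_endAlgRat_eq_bot h3⟩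

/-- **An abelian threefold with `End_ℚ(X) = ℚ` has `Hg(X) = Sp(V, E)` for EVERY polarisation `E`.** [cite: MoonenZarhin1999LowDim, §2 (2.3)] -/
theorem forall_hodgeGroup_eq_spGroup_of_finrank_eq_three_of_endAlgRat_eq_bot [FiniteDimensional ℂ E]
    (h3 : finrank ℂ E = 3) (hE : endAlgRat Φ = ⊥) :
    ∀ η : E [⋀^Fin 2]→L[ℝ] ℝ, IsRiemannForm Φ η → hodgeGroup Φ = spGroup Φ η := fun _ hη ↦
  hη.hodgeGroup_eq_spGroup_of_finrank_eq_three_of_endAlgRat_eq_bot h3 hE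

/-- **An abelian threefold is Hodge-general (for some, equivalently every, polarisation) iff `End_ℚ(X) = ℚ`.**
[cite: MoonenZarhin1999LowDim, §2 (2.3)] [cite: Lange2023AbelianVarietiesComplex, §7.3.1 Prop. 7.3.2–7.3.3] -/
theorem IsAbelianVariety.exists_hodgeGroup_eq_spGroup_iff_endAlgRat_eq_bot_of_finrank_eq_three [FiniteDimensional ℂ E]
    (hX : IsAbelianVariety Φ) (h3 : finrank ℂ E = 3) :
    (∃ η : E [⋀^Fin 2]→L[ℝ] ℝ, IsRiemannForm Φ η ∧ hodgeGroup Φ = spGroup Φ η) ↔ endAlgRat Φ = ⊥ := by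
  obtain ⟨η₀, hη₀⟩ := hX
  exact ⟨fun ⟨_, hη, h⟩ ↦ hη.endAlgRat_eq_bot_of_hodgeGroup_eq_spGroup h,
    fun hE ↦ ⟨η₀, hη₀, hη₀.hodgeGroup_eq_spGroup_of_finrank_eq_three_of_endAlgRat_eq_bot h3 hE⟩⟩

/-- **`dim_ℝ 𝔥𝔤_ℝ = 21 = dim Sp₆`** for an abelian threefold with `End_ℚ(X) = ℚ` (`g(2g+1)` at `g = 3`).
[cite: MoonenZarhin1999LowDim, §2 (2.3) ("`≅ Sp_{6,ℚ}`")] [cite: Lange2023AbelianVarietiesComplex, §7.3.1, proof of Prop. 7.3.2] -/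
theorem IsRiemannForm.finrank_hodgeGroupLie_eq_of_finrank_eq_three_of_endAlgRat_eq_bot [FiniteDimensional ℂ E]
    (hη : IsRiemannForm Φ η) (h3 : finrank ℂ E = 3) (hE : endAlgRat Φ = ⊥) : finrank ℝ (hodgeGroupLie Φ) = 21 := by
  rw [hη.hodgeGroup_eq_spGroup_iff_finrank_hodgeGroupLie_eq.1
    (hη.hodgeGroup_eq_spGroup_of_finrank_eq_three_of_endAlgRat_eq_bot h3 hE), h3]

/-- **`dim_ℂ 𝔤^{-1,1} = 6 = dim_ℂ 𝔥₃`** for an abelian threefold with `End_ℚ(X) = ℚ`.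
[cite: MoonenZarhin1999LowDim, §2 (2.3)] [cite: GreenGriffithsKerr2012, §II.A (p. 46)] -/
theorem IsRiemannForm.finrank_hodgeLieType_one_eq_six_of_finrank_eq_three_of_endAlgRat_eq_bot [FiniteDimensional ℂ E]
    (hη : IsRiemannForm Φ η) (h3 : finrank ℂ E = 3) (hE : endAlgRat Φ = ⊥) : finrank ℂ (hodgeLieType Φ 1) = 6 := by
  rw [hη.finrank_hodgeLieType_one_eq_choose_two_of_hodgeGroup_eq_spGroup
    (hη.hodgeGroup_eq_spGroup_of_finrank_eq_three_of_endAlgRat_eq_bot h3 hE), h3]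
  rfl

/-- **"`B(Xⁿ) = D(Xⁿ)` FOR ALL `n`" for abelian threefolds with `End_ℚ(X) = ℚ`**: every power has its Hodge classes of every
codimension spanned by products of divisor classes. [cite: MoonenZarhin1999LowDim, §2 p. 715 and (2.3), (1.8)]
[cite: Lange2023AbelianVarietiesComplex, §7.3.2 Prop. 7.3.3 and Thm. 7.3.4] [cite: Gordon1997, Thm. 7.5] -/
theorem IsRiemannForm.forall_divisorClasses_eq_hodgeClasses_powPeriod_of_finrank_eq_three_of_endAlgRat_eq_bot
    [FiniteDimensional ℂ E] (hη : IsRiemannForm Φ η) (h3 : finrank ℂ E = 3) (hE : endAlgRat Φ = ⊥) :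
    ∀ k p : ℕ, divisorClasses (powPeriod Φ k) p = hodgeClasses (powPeriod Φ k) p :=
  hη.forall_divisorClasses_eq_hodgeClasses_powPeriod_of_hodgeGroup_eq_spGroup Φ
    (hη.hodgeGroup_eq_spGroup_of_finrank_eq_three_of_endAlgRat_eq_bot h3 hE)

/-- The `IsAbelianVariety` form of "`B(Xⁿ) = D(Xⁿ)` for all `n`" for abelian threefolds with `End_ℚ(X) = ℚ`.
[cite: MoonenZarhin1999LowDim, §2 p. 715 and (2.3)] [cite: Lange2023AbelianVarietiesComplex, §7.3.2 Prop. 7.3.3] -/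
theorem IsAbelianVariety.forall_divisorClasses_eq_hodgeClasses_powPeriod_of_finrank_eq_three_of_endAlgRat_eq_bot
    [FiniteDimensional ℂ E] (hX : IsAbelianVariety Φ) (h3 : finrank ℂ E = 3) (hE : endAlgRat Φ = ⊥) :
    ∀ k p : ℕ, divisorClasses (powPeriod Φ k) p = hodgeClasses (powPeriod Φ k) p := by
  obtain ⟨η, hη⟩ := hX
  exact hη.forall_divisorClasses_eq_hodgeClasses_powPeriod_of_finrank_eq_three_of_endAlgRat_eq_bot h3 hE

/-- **"For `g := dim(X) ≤ 3` … we always find that `Hg(X) = Sp(V, φ)`" in the case `End_ℚ(X) = ℚ`**: a polarised complex torus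
of dimension `2` or `3` with `End_ℚ(X) = ℚ` is Hodge-general (dimension `1`: every elliptic curve has `Hg = SL₂ = Sp₂`, the
tree's `ComplexTorusEllipticCurveHodgeGroupNonCM`; not restated). [cite: MoonenZarhin1999LowDim, §2 p. 715, (2.2) and (2.3)] -/
theorem IsRiemannForm.hodgeGroup_eq_spGroup_of_finrank_le_three_of_endAlgRat_eq_bot [FiniteDimensional ℂ E]
    (hη : IsRiemannForm Φ η) (h2 : 2 ≤ finrank ℂ E) (h3 : finrank ℂ E ≤ 3) (hE : endAlgRat Φ = ⊥) :
    hodgeGroup Φ = spGroup Φ η := by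
  have h : finrank ℂ E = 2 ∨ finrank ℂ E = 3 := by omega
  rcases h with h | h
  · exact hη.hodgeGroup_eq_spGroup_of_finrank_eq_two_of_endAlgRat_eq_bot h hE
  · exact hη.hodgeGroup_eq_spGroup_of_finrank_eq_three_of_endAlgRat_eq_bot h hE

end Threefold

end ComplexTorus

end Literature.Geometry.Kaehler
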